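import Mathlib
import HarnessLib
import Literature.Analysis.FluidPDE.CollisionalTransfer
import Literature.Analysis.FluidPDE.CollisionalTransferMeasurable
import Literature.Analysis.FluidPDE.CollisionalTransferFunctional
import Literature.Analysis.FunctionSpaces.TorusConvolution
import Literature.MathematicalPhysics.KineticTheory.HardSphereEulerProofs
import Summits.AtomisticToContinuum.HydrodynamicLimit.Theorems.CollisionIsometryCLTMacroClosureStubBalanceB4
import Summits.AtomisticToContinuum.HydrodynamicLimit.Theorems.JParityClosureAssemblyEnergyModulus
import Summits.AtomisticToContinuum.HydrodynamicLimit.Theorems.AnnealedZeroHorizonMeanFluxClosureEnergyCommutatorBoundary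
import Summits.AtomisticToContinuum.HydrodynamicLimit.Theorems.AnnealedZeroHorizonMeanFluxClosureStreamingStressCommutator
import Summits.AtomisticToContinuum.HydrodynamicLimit.Theorems.AnnealedZeroHorizonMeanFluxClosureCollisionalEnergyCurrentClosureB
import Summits.AtomisticToContinuum.HydrodynamicLimit.Theorems.AnnealedZeroHorizonMeanFluxClosureCollisionalStressClosureB
import Summits.AtomisticToContinuum.HydrodynamicLimit.Theorems.AnnealedZeroHorizonMeanFluxClosureIdealEnergyCurrentClosureD
import Literature.MathematicalPhysics.KineticTheory.HardSphereCanonicalTorus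

/-!
# Skeleton (line `registered` = Lines/birth.lean, lead reshape r8, continuation c2) for crux `MeanFluxClosure` —
# route AnnealedZeroHorizon, item stmt-AtomisticToContinuum-9256

Lead reshape of the BC3 birth skeleton (planner-skel-…-9256-0, sha ed26aca8; c1 reshapes r1–r6; c2 reshape r7). The
planner's two stubs (stress closure ∥ heat-flux closure, each half of the crux verbatim) are THEOREMS
(`momentumFluxClosure`, `energyFluxClosure`) derived sorry-free from finer stubs through the exact PATHWISE balance laws of
the hard-sphere flow (Literature `CollisionalTransfer`: `HardSphereFlow.momentumObservable_sub_eq_torus` /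
`energyObservable_sub_eq_torus`) and absolute continuity of the local Gibbs law. With `c = (N+1)⁻¹`, `K` = ∫ streaming,
`T` = ∫∫ k-mollified kinetic stress (resp. energy current) tested with ∇φ (resp. ∇ψ), `W` = collisional transfer over
`(t₁, t₂]`, `S` = its CONTACT form (collisional stress `collisionalStress (Dφ)`, resp. contact energy current), `I` = the
crux's closure-flux integral (FULL pressure `p = hsPressure σ R Θ = RΘ Z(Rσ³)`) and `J` = the same with the IDEAL pressure
`RΘ` (EOS-free), the crux defect is, almost surely,
`D = (cK − T) + (T − J) + c(W − S) + (cS + J − I)` for momentum and for energy. Registered stubs (r8: SIX, ≤ stubs_max):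

* KS-a `stub_streamingStressCommutator` — LANDED p144915 (c1): `E[cK_φ − T_φ] → 0` (mollification commutator).
* KS-b `stub_deviatoricStressClosure` (EOS-free, OPEN = (D1)): `E[T_φ − J_φ] → 0` ≡ `E∫∫Dev^k:∇φ → 0` by the landed exact
  identity `…Theorems.stub_deviatoricStressClosure_identity` (p148784); its `Integrable` conjunct holds at every N with a
  uniform mean bound (`…stub_deviatoricStressClosure_integrable`, p149928) and its mean is EXACTLY 0 at constant profiles
  (`…stub_deviatoricStressClosure_equilibrium`, p151142).
* FLUX-RS `stub_relSpeedCollisionMeanBound` (EOS-free; OPEN out of equilibrium, PROVED at constant profiles p147712):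
  `E[σ_N c RS] ≤ C`, RS the windowed pre-collisional relative-speed functional.
* VIRIAL `stub_collisionalVirialClosure` (OPEN = (D1) + EOS): `E[c·collisionalStress(Dφ) + J_φ − I_φ] → 0` — the virial
  theorem in mean along the dynamics; splits exactly (landed `…stub_collisionalStressVirialSplit`, p151260) into the pressure
  closure (scalar virial ↔ `ρθ(Z−1)`, carries the EOS obstruction: `J − I` unmerged) and the EOS-free contact-isotropy closure.
  CS `stub_collisionalStressClosure` (`E[cW_φ + J_φ − I_φ] → 0`) is now a THEOREM: glue
  `fluxRS_virial_imply_collisionalStressClosure` with the landed contact-remainder bound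
  `…Theorems.stub_collisionalStressTransferMeanBound` (p149798; pathwise `|W_φ − collisionalStress(Dφ)| ≤ ¼‖D²φ‖σ_N² RS`, p149005).
* KE-a1 `stub_energyCommutatorBoundary` — LANDED p144446 (c1); with FLUX it gives KE-a `E[cK^e_ψ − T^e_ψ] → 0` through the
  lead's pathwise time-IBP (`χ := ψ − ǩ⋆ψ`), glue `flux_imply_energyCommutatorCollisions`, no cubic moment.
* FLUX `stub_collisionEnergyExchangeMeanBound` (EOS-free; OPEN out of equilibrium): `E[σ_N c 𝒮ᴱ] ≤ C`, 𝒮ᴱ the windowed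
  absolute energy-jump functional. LANDED around it (worker FLUX, c2): the constant-profile case verbatim
  (`…stub_collisionEnergyExchangeMeanBound_const`), the `Integrable` half at every N for all profiles
  (`…integrable_collisionEnergyExchange`, `…CollisionEnergyExchangeMeanBound.integrable_absEnergyJumpFunctional_flow`, p147712),
  and the kernel-checked reduction to the EXISTING crux item `Theses.BGEndpointRigidity.LanfordEnvelopeR` (stmt-13677):
  `…Theorems.stub_collisionEnergyExchangeMeanBound_of_lanfordEnvelopeR` (p148088).
* HEATFLUX `stub_scaleHeatFluxClosure` (EOS-free, OPEN = (D1), hardest; r8): `E∫∫(Dev^k u^k + q^k)·∇ψ → 0` — zero scale-ℓ heat flux +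
  velocity-weighted isotropy in mean. KE-b `stub_idealEnergyCurrentClosure` (`E[T^e_ψ − J^e_ψ] → 0`) is now a THEOREM through the landed
  identity / fixed-N integrability / glue of worker KE-b (p153816, p154235, p155195; mean EXACTLY 0 at constant profiles p154612).
* CE' `stub_collisionalEnergyContactClosure` (OPEN = (D1) + EOS): `E[c·S^e_ψ + J^e_ψ − I^e_ψ] → 0`, S^e the contact energy
  current (kernel `½ Dψ(x_i)(x_i ⊖ x_j) ΔE_i`, `ΔE_i = ⟪V, Δv_i⟫`): collisional energy transfer = excess-pressure work in mean.
  CE `stub_collisionalEnergyCurrentClosure` is now a THEOREM: glue `flux_contact_imply_collisionalEnergyCurrentClosure` with the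
  landed `…Theorems.stub_collisionalEnergyContactRemainder` (p148524; pathwise Taylor remainder `≤ ‖D²ψ‖σ_N²¼𝒮ᴱ`, p148242).

Glue (all sorry-free, axioms ⊆ {propext, Classical.choice, Quot.sound}): `commutator_deviatoric_imply_kineticStressClosure`,
`commutator_ideal_imply_kineticEnergyCurrentClosure`, `boundary_collisions_imply_streamingEnergyCommutator`,
`flux_imply_energyCommutatorCollisions`, `fluxRS_virial_imply_collisionalStressClosure`,
`flux_contact_imply_collisionalEnergyCurrentClosure`, `kinetic_collisional_imply_momentumFluxClosure`,
`kinetic_collisional_imply_energyFluxClosure`, the planner's `parts_imply_meanFluxClosure` (verbatim), and `MeanFluxClosure_of`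
concluding the crux BY NAME. Stub conclusions are written `∀ D, D = (fun z => …) → Integrable D μ ∧ |∫ D ∂μ| ≤ ε` with the
k-mollified fields WRITTEN OUT (no `let … :=` inside registered signatures: the stub registrar truncates at the first `:=`;
the crux-verbatim statements `MomentumFluxClosure`/`EnergyFluxClosure`/`PartsImplyMeanFluxClosure` keep the crux's `let`s, the
two forms being definitionally equal). Hardest stub: `stub_scaleHeatFluxClosure`. EOS obstruction (CS/VIRIAL, CE/CE', and
the crux itself): `hsPressure σ R Θ` is evaluated at the uncontrolled pathwise window packing `Rσ³` (up to ≈ √2 at finite N),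
where `deriv hsExcessFreeEnergy` is unknown — `Integrable D` is undecidable from the tree for those functionals; repair =
clamp the pressure's density argument (lead memo). Disproof used: none exists (`ledger crux ls`: no Disproof.lean, 2026-08-17).
-/

namespace Summit.AtomisticToContinuum.HydrodynamicLimit.Cruxes.MeanFluxClosure.Birth

open scoped BigOperators Topology Classical MeasureTheory ProbabilityTheory Matrix InnerProductSpace Convolution ENNReal
open Filter Set Function TopologicalSpace MeasureTheory
open Literature.Analysis.FluidPDE Literature.Analysis.FunctionSpaces
open Literature.MathematicalPhysics.KineticTheory
open Summit.AtomisticToContinuum.HydrodynamicLimit.Theorems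
open Summit.AtomisticToContinuum.HydrodynamicLimit.Theorems.MacroClosureLine.Barycentric
open Summit.AtomisticToContinuum.HydrodynamicLimit.Theorems.JParityClosureMomentumModulus
open Summit.AtomisticToContinuum.HydrodynamicLimit.Theorems.JParityClosureEnergyModulus

noncomputable section

/-! ## The registered stubs (r8: six open/registered; KS-a, KE-a1 landed; CS, CE, KE-b theorems) -/

/-- stub KS-a — STREAMING-STRESS MOLLIFICATION COMMUTATOR (EOS-free) — LANDED p144915 when generated with
LANDED_KSA (Theorems/AnnealedZeroHorizonMeanFluxClosureStreamingStressCommutator.lean). Same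
quantifier prefix as the crux; for every smooth vector field φ there is ℓ > 0 such that for every
continuous probability kernel k supported in the ℓ-ball, eventually in N, the functional
`z ↦ (N+1)⁻¹ ∫_{t₁}^{t₂} Σ_a ⟪Dφ(x_a(s)) v_a(s), v_a(s)⟫ ds
      − ∫_{t₁}^{t₂} ∫_x (N+1)⁻¹ Σ_a k(x − x_a(s)) Σ_ij v_a^i v_a^j ∂_jφ_i(x) dx ds`
(kinetic stress tested with ∇φ AT the particles minus the k-MOLLIFIED kinetic stress tested with ∇φ) is
integrable under the local Gibbs law with |expectation| ≤ ε. Proof route: swap the finite sum and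
`∫_x` (`integral_finset_sum`, `∫ k = 1`): the integrand is `(N+1)⁻¹Σ_a Σ_ij v_a^iv_a^j [∂_jφ_i(x_a) −
∫ k(x−x_a)∂_jφ_i(x)dx]` and `|∂_jφ_i(x_a) − ∫k(x−x_a)∂_jφ_i(x)dx| ≤ ω(ℓ) := sup_{euclidDist(x,y)<ℓ}
|∂φ(x)−∂φ(y)| → 0` (uniform continuity of `∂φ` on the compact torus, k ≥ 0, ∫k = 1, supp k ⊂ B_ℓ),
so pathwise `|F z| ≤ 9 ω(ℓ) ∫_{t₁}^{t₂} (N+1)⁻¹Σ_a|v_a(s)|² ds = 9ω(ℓ)(t₂−t₁)(N+1)⁻¹Σ_a|v_a(0)|²` on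
the good set (energy conservation `configEnergy_eq_holds`), and `E (N+1)⁻¹Σ|v_a(0)|² ≤ 3 sup θ₀ +
sup|u₀|²` (`integrable_avg_norm_sq_vel_flow`, Theorems/RelayRaceLocalityRestartPrincipleMeanClosureTools;
`isProbabilityMeasure_localGibbsLaw` for σ ≤ 1/2); measurability of the window integral along the flow
by `HardSphereFlow.aemeasurable_intervalIntegral_comp_flow_torus` (HardSphereFlowJointMeasurable).
Choose ℓ with 9ω(ℓ)(t₂−t₁)(3 sup θ₀ + sup|u₀|²) ≤ ε; σ₀ := 1/2. Leans on: `momentumStreaming`,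
`Torus.fderiv_apply_eq_sum_partialDeriv`, `localGibbsLaw`, `Torus.partialDeriv`. -/
theorem stub_streamingStressCommutator : ∀ (a₀ θ₀ : Literature.MathematicalPhysics.KineticTheory.T3 → ℝ) (u₀ : Literature.MathematicalPhysics.KineticTheory.T3 → Literature.MathematicalPhysics.KineticTheory.V3), Continuous a₀ → Continuous θ₀ → Continuous u₀ → (∀ x, 0 < a₀ x) → (∀ x, 0 < θ₀ x) → ∃ σ₀ : ℝ, 0 < σ₀ ∧ ∀ σ : ℝ, 0 < σ → σ < σ₀ → ∀ Φ : (N : ℕ) → Literature.Analysis.FluidPDE.HardSphereFlow (Literature.Analysis.FluidPDE.Torus.geometry (Fin 3)) (Literature.MathematicalPhysics.KineticTheory.hsDiameter σ N) (N + 1), ∀ t₁ t₂ : ℝ, 0 ≤ t₁ → t₁ ≤ t₂ → ∀ ε : ℝ, 0 < ε → (∀ φ : Literature.MathematicalPhysics.KineticTheory.T3 → Literature.MathematicalPhysics.KineticTheory.V3, Literature.Analysis.FunctionSpaces.Torus.IsSmooth φ → ∃ ℓ : ℝ, 0 < ℓ ∧ ∀ k : Literature.MathematicalPhysics.KineticTheory.T3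 → ℝ, (Continuous k ∧ (∀ y, 0 ≤ k y) ∧ (∫ y, k y = 1) ∧ (∀ y, k y ≠ 0 → Literature.Analysis.FluidPDE.Torus.euclidDist y 0 < ℓ)) → ∀ᶠ N in Filter.atTop, ∀ D : Literature.Analysis.FluidPDE.Config (N + 1) (Fin 3) Literature.MathematicalPhysics.KineticTheory.T3 → ℝ, D = (fun z => ((N + 1 : ℕ) : ℝ)⁻¹ * (∫ s in t₁..t₂, Literature.Analysis.FluidPDE.momentumStreaming φ ((Φ N).flow s z)) - ∫ s in t₁..t₂, ∫ x, ((N + 1 : ℕ) : ℝ)⁻¹ * ∑ a, k (x - ((Φ N).flow s z a).1) * (∑ i, ∑ j, ((Φ N).flow s z a).2 i * ((Φ N).flow s z a).2 j * Literature.Analysis.FunctionSpaces.Torus.partialDeriv j (fun y => φ y i) x)) → MeasureTheory.Integrable D (Literature.MathematicalPhysics.KineticTheory.localGibbsLaw σ a₀ u₀ θ₀ N (Φ N)) ∧ |∫ z, D z ∂Literature.MathematicalPhysics.KineticTheory.localGibbsLaw σ a₀ u₀ θ₀ N (Φ N)| ≤ ε) := 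
  Summit.AtomisticToContinuum.HydrodynamicLimit.Theorems.stub_streamingStressCommutator

/-- stub KS-b — DEVIATORIC (KINETIC-STRESS) CLOSURE IN MEAN (EOS-free; OPEN — the quadratic-moment
local-equilibrium input). Same prefix; eventually in N the functional
`z ↦ ∫_{t₁}^{t₂}∫_x (N+1)⁻¹Σ_a k(x−x_a(s)) Σ_ij v_a^iv_a^j ∂_jφ_i(x) dx ds
      − ∫_{t₁}^{t₂}∫_x [(m^k⊗m^k/ρ^k):∇φ + ρ^kθ^k div φ] dx ds`
(k-mollified kinetic stress `S^k` tested with ∇φ minus the IDEAL Euler stress of the k-mollified fields,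
`θ^k = ⅔(E^k/ρ^k − |m^k|²/2(ρ^k)²)`) is integrable with |expectation| ≤ ε. By the EXACT pointwise identity
`S^k = m^k⊗m^k/ρ^k + ρ^kθ^k 𝟙 + Dev^k` (`Dev^k` := traceless part of the scale-ℓ peculiar stress
`P^k_ij = (N+1)⁻¹Σ_a k(x−x_a)(v_a−u^k)_i(v_a−u^k)_j`, `u^k = m^k/ρ^k`, `tr P^k = 3ρ^kθ^k` by definition
of θ^k; all terms vanish where ρ^k = 0) the functional IS `∫∫ Dev^k : ∇φ`: the claim is isotropy IN
MEAN of the scale-ℓ peculiar velocity covariance along the deterministic dynamics, after N → ∞ at fixed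
k. True at s = 0 up to O(ℓ²‖∇u₀‖²) (local Maxwellians are isotropic); for s > 0 it is the
MacroErgodicity/BoltzmannHypothesis input in its weakest (annealed, quadratic) form — isolated, not
evaded. All integrands are bounded by (N+1)⁻¹Σ_a k(x−x_a)|v_a|² ‖∇φ‖_∞ (Cauchy–Schwarz), so
integrability is NOT the issue here. Leans on: empirical fields, `localGibbsLaw`, `Torus.partialDeriv`,
`Torus.divergence`. -/
theorem stub_deviatoricStressClosure : ∀ (a₀ θ₀ : Literature.MathematicalPhysics.KineticTheory.T3 → ℝ) (u₀ : Literature.MathematicalPhysics.KineticTheory.T3 → Literature.MathematicalPhysics.KineticTheory.V3), Continuous a₀ → Continuous θ₀ → Continuous u₀ → (∀ x, 0 < a₀ x) → (∀ x, 0 < θ₀ x) → ∃ σ₀ : ℝ, 0 < σ₀ ∧ ∀ σ : ℝ, 0 < σ → σ < σ₀ → ∀ Φ : (N : ℕ) → Literature.Analysis.FluidPDE.HardSphereFlow (Literature.Analysis.FluidPDE.Torus.geometry (Fin 3)) (Literature.MathematicalPhysics.KineticTheory.hsDiameter σ N) (N + 1), ∀ t₁ t₂ : ℝ, 0 ≤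 t₁ → t₁ ≤ t₂ → ∀ ε : ℝ, 0 < ε → (∀ φ : Literature.MathematicalPhysics.KineticTheory.T3 → Literature.MathematicalPhysics.KineticTheory.V3, Literature.Analysis.FunctionSpaces.Torus.IsSmooth φ → ∃ ℓ : ℝ, 0 < ℓ ∧ ∀ k : Literature.MathematicalPhysics.KineticTheory.T3 → ℝ, (Continuous k ∧ (∀ y, 0 ≤ k y) ∧ (∫ y, k y = 1) ∧ (∀ y, k y ≠ 0 → Literature.Analysis.FluidPDE.Torus.euclidDist y 0 < ℓ)) → ∀ᶠ N in Filter.atTop, ∀ D : Literature.Analysis.FluidPDE.Config (N + 1) (Fin 3) Literature.MathematicalPhysics.KineticTheory.T3 → ℝ, D = (fun z => (∫ s in t₁..t₂, ∫ x, ((N + 1 : ℕ) : ℝ)⁻¹ * ∑ a, k (x - ((Φ N).flow s z a).1) * (∑ i, ∑ j, ((Φ N).flow s z a).2 i * ((Φ N).flow s z a).2 j * Literature.Analysis.FunctionSpaces.Torus.partialDeriv j (fun y => φ y i) x)) - (∫ s in t₁..t₂, ∫ x, ((∑ i, ∑ j, (Literature.MathematicalPhysics.KineticTheory.empiricalMomentumField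 ((Φ N).flow s z) (fun y => k (x - y)) i * Literature.MathematicalPhysics.KineticTheory.empiricalMomentumField ((Φ N).flow s z) (fun y => k (x - y)) j / Literature.MathematicalPhysics.KineticTheory.empiricalDensityField ((Φ N).flow s z) (fun y => k (x - y))) * Literature.Analysis.FunctionSpaces.Torus.partialDeriv j (fun y => φ y i) x) + Literature.MathematicalPhysics.KineticTheory.empiricalDensityField ((Φ N).flow s z) (fun y => k (x - y)) * (2 / 3 * (Literature.MathematicalPhysics.KineticTheory.empiricalEnergyField ((Φ N).flow s z) (fun y => k (x - y)) / Literature.MathematicalPhysics.KineticTheory.empiricalDensityField ((Φ N).flow s z) (fun y => k (x - y)) - ‖Literature.MathematicalPhysics.KineticTheory.empiricalMomentumField ((Φ N).flow s z) (fun y => k (x - y))‖ ^ 2 / (2 * Literature.MathematicalPhysics.KineticTheory.empiricalDensityField ((Φ N).flow s z) (fun y => k (x - y)) ^ 2))) * Literature.Analysis.FunctionSpaces.Torus.divergence φ x))) → MeasureTheory.Integrable D (Literature.MathematicalPhysics.KineticTheory.localGibbsLaw σ a₀ u₀ θ₀ N (Φ N)) ∧ |∫ z, D z ∂Literature.MathematicalPhysics.KineticTheory.localGibbsLaw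 σ a₀ u₀ θ₀ N (Φ N)| ≤ ε) := by
  sorry

/-- stub FLUX-RS — MEAN RELATIVE-SPEED COLLISION-FLUX BOUND (EOS-free, cutoff-free; OPEN out of equilibrium,
PROVED at constant profiles: `…Theorems.CollisionEnergyExchangeMeanBound.relSpeedFunctional_flow_const`, p147712; integrability
half at every N for all profiles: `…integrable_relSpeedFunctional_flow`). The momentum twin of stub FLUX: same prefix, and
eventually in N the functional `z ↦ σ_N (N+1)⁻¹ RS(z)`, `RS(z) = Σ_{t_c ∈ (t₁,t₂]} Σ_{(i,j) colliding} ‖v_i⁻ − v_j⁻‖` (Literature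
`HardSphereFlow.collisionalTransferFunctional` of the time-t₁ point over `(0, t₂−t₁]` with the pre-collisional relative-speed
kernel), is integrable under the local Gibbs law with expectation ≤ C. Kinetic order O(σ³√θ(t₂−t₁)) (`mmr_collisionFlux_const`:
`≤ 80σ³(3θ+‖u‖²)(t₂−t₁)` in equilibrium). It dominates the collisional momentum transfer (`|W_φ| ≤ ‖Dφ‖ σ_N ½RS`) and its contact
(Taylor) remainder (`|W_φ − collisionalStress(Dφ)| ≤ ¼‖D²φ‖ σ_N² RS`, landed `…Theorems.stub_collisionalStressContactRemainder`,
p149005), whence the glue `fluxRS_virial_imply_collisionalStressClosure` below. Missing input out of equilibrium: the same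
uniform-in-time contact-flux / marginal-envelope bound as for FLUX (crux item `Theses.BGEndpointRigidity.LanfordEnvelopeR`,
stmt-AtomisticToContinuum-13677, gives it: cf. `…stub_collisionEnergyExchangeMeanBound_of_lanfordEnvelopeR`, p148088, whose
engine `stub_of_marginalEnvelope` is generic in the mark). Leans on: `HardSphereFlow.collisionalTransferFunctional`, `hsDiameter`,
`localGibbsLaw`. -/
theorem stub_relSpeedCollisionMeanBound : ∀ (a₀ θ₀ : Literature.MathematicalPhysics.KineticTheory.T3 → ℝ) (u₀ : Literature.MathematicalPhysics.KineticTheory.T3 → Literature.MathematicalPhysics.KineticTheory.V3), Continuous a₀ → Continuous θ₀ → Continuous u₀ → (∀ x, 0 < a₀ x) → (∀ x, 0 < θ₀ x) → ∃ σ₀ : ℝ, 0 < σ₀ ∧ ∀ σ : ℝ, 0 < σ → σ < σ₀ → ∀ Φ : (N : ℕ) → Literature.Analysis.FluidPDE.HardSphereFlow (Literature.Analysis.FluidPDE.Torus.geometry (Fin 3)) (Literature.MathematicalPhysics.KineticTheory.hsDiameter σ N) (N + 1), ∀ t₁ t₂ : ℝ, 0 ≤ t₁ → t₁ ≤ t₂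 → ∃ C : ℝ, ∀ᶠ N in Filter.atTop, ∀ Q : Literature.Analysis.FluidPDE.Config (N + 1) (Fin 3) Literature.MathematicalPhysics.KineticTheory.T3 → ℝ, Q = (fun z => Literature.MathematicalPhysics.KineticTheory.hsDiameter σ N * ((N + 1 : ℕ) : ℝ)⁻¹ * (Φ N).collisionalTransferFunctional (fun (i j : Fin (N + 1)) (pre _post : Literature.Analysis.FluidPDE.Config (N + 1) (Fin 3) Literature.MathematicalPhysics.KineticTheory.T3) => ‖(pre i).2 - (pre j).2‖) ((Φ N).flow t₁ z) (t₂ - t₁)) → MeasureTheory.Integrable Q (Literature.MathematicalPhysics.KineticTheory.localGibbsLaw σ a₀ u₀ θ₀ N (Φ N)) ∧ ∫ z, Q z ∂Literature.MathematicalPhysics.KineticTheory.localGibbsLaw σ a₀ u₀ θ₀ N (Φ N) ≤ C := by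
  sorry

/-- stub VIRIAL — MEAN COLLISIONAL-STRESS (VIRIAL) CLOSURE IN CONTACT FORM (OPEN; carries the hard-sphere equation of
state). Stub CS with the collisional momentum transfer `W_φ` replaced by its contact (trapezoidal Taylor) form, the
COLLISIONAL STRESS `collisionalStress (Dφ) = Σ_{t_c ∈ (t₁,t₂]} ½⟪(Dφ(x_i) + Dφ(x_j))(x_i ⊖ x_j), Δv_i⟫` (Literature
`HardSphereFlow.collisionalStress`; at a collision `Δv_i = λ n`, so each term is `λ σ_N ⟪Dφ n, n⟫`, a quadratic form in the
contact direction): eventually in N `z ↦ (N+1)⁻¹ collisionalStress(Dφ)(Φ_{t₁}z, t₂−t₁) + J_φ(z) − I_φ(z)` is integrable with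
|expectation| ≤ ε, i.e. the collisional stress equals in mean `−∫∫ ρ^kθ^k(Z(ρ^kσ³) − 1) div φ` (virial theorem IN MEAN along
the dynamics, Spohn 1991 I (3.15)). By the landed exact split `…Theorems.stub_collisionalStressVirialSplit` (p151260)
`collisionalStress(Dφ) = collisionalVirial(div φ/3) + collisionalStress(Dφ − (div φ/3)𝟙)` this is the sum of the PRESSURE closure
(scalar virial ↔ excess pressure `ρθ(Z−1)`: contact value of the pair law = thermodynamic, in mean; carries the whole EOS
obstruction — `deriv hsExcessFreeEnergy` at the uncontrolled window packing, so `J − I` stays unmerged and even `Integrable D`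
is undecidable from the tree) and the EOS-free CONTACT-ISOTROPY closure (traceless part → 0 in mean; the collisional twin of
KS-b). Leans on: `HardSphereFlow.collisionalStress`, `Torus.fderiv`, `hsPressure`, empirical fields, `localGibbsLaw`. -/
theorem stub_collisionalVirialClosure : ∀ (a₀ θ₀ : Literature.MathematicalPhysics.KineticTheory.T3 → ℝ) (u₀ : Literature.MathematicalPhysics.KineticTheory.T3 → Literature.MathematicalPhysics.KineticTheory.V3), Continuous a₀ → Continuous θ₀ → Continuous u₀ → (∀ x, 0 < a₀ x) → (∀ x, 0 < θ₀ x) → ∃ σ₀ : ℝ, 0 < σ₀ ∧ ∀ σ : ℝ, 0 < σ → σ < σ₀ → ∀ Φ : (N : ℕ) → Literature.Analysis.FluidPDE.HardSphereFlow (Literature.Analysis.FluidPDE.Torus.geometry (Fin 3)) (Literature.MathematicalPhysics.KineticTheory.hsDiameter σ N) (N + 1), ∀ t₁ t₂ : ℝ, 0 ≤ t₁ → t₁ ≤ t₂ → ∀ ε : ℝ, 0 < ε → (∀ φ : Literature.MathematicalPhysics.KineticTheory.T3 → Literature.MathematicalPhysics.KineticTheory.V3, Literature.Analysis.FunctionSpaces.Torus.IsSmooth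 φ → ∃ ℓ : ℝ, 0 < ℓ ∧ ∀ k : Literature.MathematicalPhysics.KineticTheory.T3 → ℝ, (Continuous k ∧ (∀ y, 0 ≤ k y) ∧ (∫ y, k y = 1) ∧ (∀ y, k y ≠ 0 → Literature.Analysis.FluidPDE.Torus.euclidDist y 0 < ℓ)) → ∀ᶠ N in Filter.atTop, ∀ D : Literature.Analysis.FluidPDE.Config (N + 1) (Fin 3) Literature.MathematicalPhysics.KineticTheory.T3 → ℝ, D = (fun z => ((N + 1 : ℕ) : ℝ)⁻¹ * (Φ N).collisionalStress (Literature.Analysis.FunctionSpaces.Torus.fderiv φ) ((Φ N).flow t₁ z) (t₂ - t₁) + (∫ s in t₁..t₂, ∫ x, ((∑ i, ∑ j, (Literature.MathematicalPhysics.KineticTheory.empiricalMomentumField ((Φ N).flow s z) (fun y => k (x - y)) i * Literature.MathematicalPhysics.KineticTheory.empiricalMomentumField ((Φ N).flow s z) (fun y => k (x - y)) j / Literature.MathematicalPhysics.KineticTheory.empiricalDensityField ((Φ N).flow s z) (fun y => k (x - y))) * Literature.Analysis.FunctionSpaces.Torus.partialDeriv j (fun y => φ y i) x) + Literature.MathematicalPhysics.KineticTheory.empiricalDensityField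 ((Φ N).flow s z) (fun y => k (x - y)) * (2 / 3 * (Literature.MathematicalPhysics.KineticTheory.empiricalEnergyField ((Φ N).flow s z) (fun y => k (x - y)) / Literature.MathematicalPhysics.KineticTheory.empiricalDensityField ((Φ N).flow s z) (fun y => k (x - y)) - ‖Literature.MathematicalPhysics.KineticTheory.empiricalMomentumField ((Φ N).flow s z) (fun y => k (x - y))‖ ^ 2 / (2 * Literature.MathematicalPhysics.KineticTheory.empiricalDensityField ((Φ N).flow s z) (fun y => k (x - y)) ^ 2))) * Literature.Analysis.FunctionSpaces.Torus.divergence φ x)) - (∫ s in t₁..t₂, ∫ x, ((∑ i, ∑ j, (Literature.MathematicalPhysics.KineticTheory.empiricalMomentumField ((Φ N).flow s z) (fun y => k (x - y)) i * Literature.MathematicalPhysics.KineticTheory.empiricalMomentumField ((Φ N).flow s z) (fun y => k (x - y)) j / Literature.MathematicalPhysics.KineticTheory.empiricalDensityField ((Φ N).flow s z) (fun y => k (x - y))) * Literature.Analysis.FunctionSpaces.Torus.partialDeriv j (fun y => φ y i) x) + Literature.MathematicalPhysics.KineticTheory.hsPressure σ (Literature.MathematicalPhysics.KineticTheory.empiricalDensityField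 ((Φ N).flow s z) (fun y => k (x - y))) (2 / 3 * (Literature.MathematicalPhysics.KineticTheory.empiricalEnergyField ((Φ N).flow s z) (fun y => k (x - y)) / Literature.MathematicalPhysics.KineticTheory.empiricalDensityField ((Φ N).flow s z) (fun y => k (x - y)) - ‖Literature.MathematicalPhysics.KineticTheory.empiricalMomentumField ((Φ N).flow s z) (fun y => k (x - y))‖ ^ 2 / (2 * Literature.MathematicalPhysics.KineticTheory.empiricalDensityField ((Φ N).flow s z) (fun y => k (x - y)) ^ 2))) * Literature.Analysis.FunctionSpaces.Torus.divergence φ x))) → MeasureTheory.Integrable D (Literature.MathematicalPhysics.KineticTheory.localGibbsLaw σ a₀ u₀ θ₀ N (Φ N)) ∧ |∫ z, D z ∂Literature.MathematicalPhysics.KineticTheory.localGibbsLaw σ a₀ u₀ θ₀ N (Φ N)| ≤ ε) := by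
  sorry

/-- stub KE-a1 — ENERGY COMMUTATOR, BOUNDARY PART (EOS-free) — LANDED p144446
(Theorems/AnnealedZeroHorizonMeanFluxClosureEnergyCommutatorBoundary.lean, `…Theorems.stub_energyCommutatorBoundary`).
Same prefix with a smooth scalar ψ; eventually in N the functional
`z ↦ (N+1)⁻¹∫_{t₁}^{t₂} Σ_a (Dψ(x_a)v_a)|v_a|²/2 ds − ∫_{t₁}^{t₂}∫_x (N+1)⁻¹Σ_a k(x−x_a)(v_a·∇ψ(x))|v_a|²/2 dx ds
      + (N+1)⁻¹ W^e_χ(z)`, `χ := ψ − ǩ⋆ψ` (`χ y = ψ y − ∫ k(x−y)ψ(x)dx`, the mollification defect of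
the TEST FUNCTION), `W^e_χ` the collisional energy transfer of χ along the orbit of the time-t₁ point
over `(0, t₂−t₁]` (Literature `HardSphereFlow.energyTransfer`), is integrable with |expectation| ≤ ε.
KEY IDENTITY (pathwise time-integration by parts): `∇(ǩ⋆ψ) = ǩ⋆∇ψ` (TorusConvolution
`partialDeriv_convolution`) makes the commutator functional `cK^e_ψ − T^e_ψ` EQUAL to
`c∫ energyStreaming χ (Φ_s z) ds`, and the weak energy balance for the C¹ test function χ
(`energyObservable_sub_eq_torus`) turns it into `c[E_χ(Φ_{t₂}z) − E_χ(Φ_{t₁}z)] − cW^e_χ(z)` on the good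
set; so this stub's functional is a.s. `c[E_χ(Φ_{t₂}z) − E_χ(Φ_{t₁}z)]`, bounded by
`‖χ‖_∞·c(Σ|v_a(t₂)|² + Σ|v_a(t₁)|²)/2 = ‖χ‖_∞ cΣ|v_a(0)|²` (energy conservation) with
`‖χ‖_∞ ≤ ℓ sup‖∇ψ‖` (one-particle mollifier commutator, Theorems/…MacroClosureStubBalanceB4), whence
`|E| ≤ ℓ sup‖∇ψ‖ (3 sup θ₀ + sup|u₀|²) ≤ ε` for small ℓ, at EVERY N. The cubic moment never appears.
Leans on: `energyStreaming`, `HardSphereFlow.energyTransfer`, `localGibbsLaw`, `Torus.partialDeriv`,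
TorusConvolution (`isSmooth_convolution`, `partialDeriv_convolution`, `torusFderiv_convolution_apply`). -/
theorem stub_energyCommutatorBoundary : ∀ (a₀ θ₀ : Literature.MathematicalPhysics.KineticTheory.T3 → ℝ) (u₀ : Literature.MathematicalPhysics.KineticTheory.T3 → Literature.MathematicalPhysics.KineticTheory.V3), Continuous a₀ → Continuous θ₀ → Continuous u₀ → (∀ x, 0 < a₀ x) → (∀ x, 0 < θ₀ x) → ∃ σ₀ : ℝ, 0 < σ₀ ∧ ∀ σ : ℝ, 0 < σ → σ < σ₀ → ∀ Φ : (N : ℕ) → Literature.Analysis.FluidPDE.HardSphereFlow (Literature.Analysis.FluidPDE.Torus.geometry (Fin 3)) (Literature.MathematicalPhysics.KineticTheory.hsDiameter σ N) (N + 1), ∀ t₁ t₂ : ℝ, 0 ≤ t₁ → t₁ ≤ t₂ → ∀ ε : ℝ, 0 < ε → (∀ ψ : Literature.MathematicalPhysics.KineticTheory.T3 → ℝ, Literature.Analysis.FunctionSpaces.Torus.IsSmooth ψ → ∃ ℓ : ℝ, 0 < ℓ ∧ ∀ k : Literature.MathematicalPhysics.KineticTheory.T3 → ℝ, (Continuous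 k ∧ (∀ y, 0 ≤ k y) ∧ (∫ y, k y = 1) ∧ (∀ y, k y ≠ 0 → Literature.Analysis.FluidPDE.Torus.euclidDist y 0 < ℓ)) → ∀ᶠ N in Filter.atTop, ∀ D : Literature.Analysis.FluidPDE.Config (N + 1) (Fin 3) Literature.MathematicalPhysics.KineticTheory.T3 → ℝ, D = (fun z => ((N + 1 : ℕ) : ℝ)⁻¹ * (∫ s in t₁..t₂, Literature.Analysis.FluidPDE.energyStreaming ψ ((Φ N).flow s z)) - (∫ s in t₁..t₂, ∫ x, ((N + 1 : ℕ) : ℝ)⁻¹ * ∑ a, k (x - ((Φ N).flow s z a).1) * ((∑ i, ((Φ N).flow s z a).2 i * Literature.Analysis.FunctionSpaces.Torus.partialDeriv i ψ x) * (‖((Φ N).flow s z a).2‖ ^ 2 / 2))) + ((N + 1 : ℕ) : ℝ)⁻¹ * (Φ N).energyTransfer (fun y => ψ y - ∫ x, k (x - y) * ψ x) ((Φ N).flow t₁ z) (t₂ - t₁)) → MeasureTheory.Integrable D (Literature.MathematicalPhysics.KineticTheory.localGibbsLaw σ a₀ u₀ θ₀ N (Φ N)) ∧ |∫ z, D z ∂Literature.MathematicalPhysics.KineticTheory.localGibbsLaw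 σ a₀ u₀ θ₀ N (Φ N)| ≤ ε) :=
  Summit.AtomisticToContinuum.HydrodynamicLimit.Theorems.stub_energyCommutatorBoundary

/-- stub FLUX — MEAN COLLISIONAL ENERGY-EXCHANGE BOUND (EOS-free, cutoff-free; OPEN out of
equilibrium, provable in equilibrium). For all continuous positive profiles there is σ₀ > 0 such
that for 0 < σ < σ₀, every flow family and all 0 ≤ t₁ ≤ t₂ there is C such that, eventually in N,
the functional `z ↦ σ_N (N+1)⁻¹ 𝒮ᴱ(z)`, `𝒮ᴱ(z) = Σ_{t_c ∈ (t₁,t₂]} Σ_{(i,j) colliding} |Δ|v_i|²|/2`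
(Literature `HardSphereFlow.collisionalTransferFunctional` of the time-t₁ point over `(0, t₂−t₁]`
with the absolute energy-jump kernel — the windowed ENERGY-JUMP functional of
Theorems/JParityClosureAssemblyEnergyModulus; `σ_N = hsDiameter σ N`), is integrable under the local
Gibbs law with expectation ≤ C. Kinetic-theory order: σ_N × (collisions per particle over the window
≍ (N+1)^{1/3}σ²√θ(t₂−t₁)) × θ = O(σ³θ^{3/2}(t₂−t₁)). It REPLACES the cubic velocity moment of the
heat-current commutator (lead's pathwise time-IBP, glue `flux_imply_energyCommutatorCollisions`):
KE-a = KE-a1 (landed) − cW^e_χ, `|W^e_χ| ≤ Lip(χ)σ_N ½𝒮ᴱ` (`abs_energyTransfer_le`), `Lip(χ) ≤ ℓΣᵢsup‖∇∂ᵢψ‖`.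
Status: for the STATIONARY homogeneous law it follows from the tree's one-window/Campbell inequality
(`Literature…CollisionFluxMeanBound.localGibbsLaw_lintegral_le_of_le_collisionMarkSum`, hyp `hstat`)
and Gaussian moments; for the transported local Gibbs law the non-stationary inequality
(`CollisionFluxMeanBoundNonStationary.lintegral_le_liminf_mul_of_le_collisionSum`) reduces it to a
uniform-in-time bound on the CONTACT FLUX of the laws `(Φ_r)_*P`, i.e. two-particle marginals at
contact out of equilibrium — the open input (shared with Theorems/RelayRaceLocality…MmrEnergy's
`collisionFlux` hypothesis and JParityClosure's 𝒮ᴱ bound). Leans on: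
`HardSphereFlow.collisionalTransferFunctional`, `hsDiameter`, `localGibbsLaw`. -/
theorem stub_collisionEnergyExchangeMeanBound : ∀ (a₀ θ₀ : Literature.MathematicalPhysics.KineticTheory.T3 → ℝ) (u₀ : Literature.MathematicalPhysics.KineticTheory.T3 → Literature.MathematicalPhysics.KineticTheory.V3), Continuous a₀ → Continuous θ₀ → Continuous u₀ → (∀ x, 0 < a₀ x) → (∀ x, 0 < θ₀ x) → ∃ σ₀ : ℝ, 0 < σ₀ ∧ ∀ σ : ℝ, 0 < σ → σ < σ₀ → ∀ Φ : (N : ℕ) → Literature.Analysis.FluidPDE.HardSphereFlow (Literature.Analysis.FluidPDE.Torus.geometry (Fin 3)) (Literature.MathematicalPhysics.KineticTheory.hsDiameter σ N) (N + 1), ∀ t₁ t₂ : ℝ, 0 ≤ t₁ → t₁ ≤ t₂ → ∃ C : ℝ, ∀ᶠ N in Filter.atTop, ∀ Q : Literature.Analysis.FluidPDE.Config (N + 1) (Fin 3) Literature.MathematicalPhysics.KineticTheory.T3 → ℝ, Q = (fun z => Literature.MathematicalPhysics.KineticTheory.hsDiameter σ N * ((N + 1 : ℕ) : ℝ)⁻¹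 * (Φ N).collisionalTransferFunctional (fun (i _j : Fin (N + 1)) (pre post : Literature.Analysis.FluidPDE.Config (N + 1) (Fin 3) Literature.MathematicalPhysics.KineticTheory.T3) => |‖(post i).2‖ ^ 2 - ‖(pre i).2‖ ^ 2| / 2) ((Φ N).flow t₁ z) (t₂ - t₁)) → MeasureTheory.Integrable Q (Literature.MathematicalPhysics.KineticTheory.localGibbsLaw σ a₀ u₀ θ₀ N (Φ N)) ∧ ∫ z, Q z ∂Literature.MathematicalPhysics.KineticTheory.localGibbsLaw σ a₀ u₀ θ₀ N (Φ N) ≤ C := by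
  sorry

/-- stub HEATFLUX — SCALE-ℓ HEAT-FLUX CLOSURE IN MEAN (EOS-free; OPEN = (D1) — the hardest stub). Same prefix as the crux;
eventually in N `|E ∫_{t₁}^{t₂}∫_x Σ_i (Σ_j Dev^k_ij u^k_j + q^k_i) ∂_iψ dx ds| ≤ ε` along `(Φ N).flow s z` under the local Gibbs law, with
`R, Mv` the k-mollified empirical density/momentum (written out), `u^k = Mv/R`, `P_ij = (N+1)⁻¹Σ_a k(x−x_a)(v_a − u^k)_i(v_a − u^k)_j` the
scale-ℓ peculiar stress, `Dev^k = P − (tr P/3)𝟙` its traceless part and `q^k_i = (N+1)⁻¹Σ_a k(x−x_a)(v_a − u^k)_i‖v_a − u^k‖²/2` the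
scale-ℓ HEAT FLUX: zero Euler-order heat flux (odd third moments of the peculiar velocities) + velocity-weighted isotropy IN MEAN
along the deterministic dynamics — the quadratic/cubic local-equilibrium input every route to `HydrodynamicLimit` needs
(OllaVaradhanYau1993 §1 modified the kinetic energy to dodge exactly this; NachtergaeleYau2003 Assumption II.1). It REPLACES the
r1–r7 stub KE-b `stub_idealEnergyCurrentClosure` (`E[T^e_ψ − J^e_ψ] → 0`), which is now a THEOREM of the skeleton through the landed
exact identity `j_E^k − (E^k + R^kΘ^k)u^k = Dev^k u^k + q^k`, the fixed-N integrability of both functionals and the glue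
`…Theorems.stub_idealEnergyCurrentClosure_of_heatFluxClosure` (worker KE-b, c2 wave-2: p153816 identity, p154235 integrable at every N,
p154612 mean EXACTLY 0 at constant profiles, p155195 glue). No `Integrable` conjunct is needed here (landed). Leans on: empirical fields,
`localGibbsLaw`, `Torus.partialDeriv` (Literature); no unproved facts besides (D1) itself. -/
theorem stub_scaleHeatFluxClosure : ∀ (a₀ θ₀ : Literature.MathematicalPhysics.KineticTheory.T3 → ℝ) (u₀ : Literature.MathematicalPhysics.KineticTheory.T3 → Literature.MathematicalPhysics.KineticTheory.V3), Continuous a₀ → Continuous θ₀ → Continuous u₀ → (∀ x, 0 < a₀ x) → (∀ x, 0 < θ₀ x) → ∃ σ₀ : ℝ, 0 < σ₀ ∧ ∀ σ : ℝ, 0 < σ → σ < σ₀ → ∀ Φ : (N : ℕ) → Literature.Analysis.FluidPDE.HardSphereFlow (Literature.Analysis.FluidPDE.Torus.geometry (Fin 3)) (Literature.MathematicalPhysics.KineticTheory.hsDiameter σ N) (N + 1), ∀ t₁ t₂ : ℝ, 0 ≤ t₁ → t₁ ≤ t₂ → ∀ ε : ℝ, 0 < ε → (∀ ψ : Literature.MathematicalPhysics.KineticTheory.T3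 → ℝ, Literature.Analysis.FunctionSpaces.Torus.IsSmooth ψ → ∃ ℓ : ℝ, 0 < ℓ ∧ ∀ k : Literature.MathematicalPhysics.KineticTheory.T3 → ℝ, (Continuous k ∧ (∀ y, 0 ≤ k y) ∧ (∫ y, k y = 1) ∧ (∀ y, k y ≠ 0 → Literature.Analysis.FluidPDE.Torus.euclidDist y 0 < ℓ)) → ∀ᶠ N in Filter.atTop, |∫ z, (∫ s in t₁..t₂, ∫ x, ∑ i, ((∑ j, (((N + 1 : ℕ) : ℝ)⁻¹ * ∑ a, k (x - ((Φ N).flow s z a).1) * ((((Φ N).flow s z a).2 i - Literature.MathematicalPhysics.KineticTheory.empiricalMomentumField ((Φ N).flow s z) (fun y => k (x - y)) i / Literature.MathematicalPhysics.KineticTheory.empiricalDensityField ((Φ N).flow s z) (fun y => k (x - y))) * (((Φ N).flow s z a).2 j - Literature.MathematicalPhysics.KineticTheory.empiricalMomentumField ((Φ N).flow s z) (fun y => k (x - y)) j / Literature.MathematicalPhysics.KineticTheory.empiricalDensityField ((Φ N).flow s z) (fun y => k (x - y)))) - (if i = j then 1 else 0) * ((∑ l, ((N + 1 : ℕ) :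 ℝ)⁻¹ * ∑ a, k (x - ((Φ N).flow s z a).1) * ((((Φ N).flow s z a).2 l - Literature.MathematicalPhysics.KineticTheory.empiricalMomentumField ((Φ N).flow s z) (fun y => k (x - y)) l / Literature.MathematicalPhysics.KineticTheory.empiricalDensityField ((Φ N).flow s z) (fun y => k (x - y))) * (((Φ N).flow s z a).2 l - Literature.MathematicalPhysics.KineticTheory.empiricalMomentumField ((Φ N).flow s z) (fun y => k (x - y)) l / Literature.MathematicalPhysics.KineticTheory.empiricalDensityField ((Φ N).flow s z) (fun y => k (x - y))))) / 3)) * (Literature.MathematicalPhysics.KineticTheory.empiricalMomentumField ((Φ N).flow s z) (fun y => k (x - y)) j / Literature.MathematicalPhysics.KineticTheory.empiricalDensityField ((Φ N).flow s z) (fun y => k (x - y)))) + ((N + 1 : ℕ) : ℝ)⁻¹ * ∑ a, k (x - ((Φ N).flow s z a).1) * ((((Φ N).flow s z a).2 i - Literature.MathematicalPhysics.KineticTheory.empiricalMomentumField ((Φ N).flow s z) (fun y => k (x - y)) i / Literature.MathematicalPhysics.KineticTheory.empiricalDensityField ((Φ N).flow s z) (fun y => k (x - y))) * ((∑ l, (((Φ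 N).flow s z a).2 l - Literature.MathematicalPhysics.KineticTheory.empiricalMomentumField ((Φ N).flow s z) (fun y => k (x - y)) l / Literature.MathematicalPhysics.KineticTheory.empiricalDensityField ((Φ N).flow s z) (fun y => k (x - y))) ^ 2) / 2))) * Literature.Analysis.FunctionSpaces.Torus.partialDeriv i ψ x) ∂Literature.MathematicalPhysics.KineticTheory.localGibbsLaw σ a₀ u₀ θ₀ N (Φ N)| ≤ ε) := by
  sorry

/-- Stub KE-b (r1–r7), now a THEOREM of the skeleton from stub HEATFLUX through the landed glue
`Summit.AtomisticToContinuum.HydrodynamicLimit.Theorems.stub_idealEnergyCurrentClosure_of_heatFluxClosure` (p155195): eventually in N the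
functional `T^e_ψ − J^e_ψ` (k-mollified kinetic energy current tested with ∇ψ minus the IDEAL enthalpy flux of the mollified fields) is
integrable under the local Gibbs law with |expectation| ≤ ε. -/
theorem stub_idealEnergyCurrentClosure : ∀ (a₀ θ₀ : Literature.MathematicalPhysics.KineticTheory.T3 → ℝ) (u₀ : Literature.MathematicalPhysics.KineticTheory.T3 → Literature.MathematicalPhysics.KineticTheory.V3), Continuous a₀ → Continuous θ₀ → Continuous u₀ → (∀ x, 0 < a₀ x) → (∀ x, 0 < θ₀ x) → ∃ σ₀ : ℝ, 0 < σ₀ ∧ ∀ σ : ℝ, 0 < σ → σ < σ₀ → ∀ Φ : (N : ℕ) → Literature.Analysis.FluidPDE.HardSphereFlow (Literature.Analysis.FluidPDE.Torus.geometry (Fin 3)) (Literature.MathematicalPhysics.KineticTheory.hsDiameter σ N) (N + 1), ∀ t₁ t₂ : ℝ, 0 ≤ t₁ → t₁ ≤ t₂ → ∀ ε : ℝ, 0 < ε → (∀ ψ : Literature.MathematicalPhysics.KineticTheory.T3 → ℝ, Literature.Analysis.FunctionSpaces.Torus.IsSmooth ψ → ∃ ℓ : ℝ, 0 < ℓ ∧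 ∀ k : Literature.MathematicalPhysics.KineticTheory.T3 → ℝ, (Continuous k ∧ (∀ y, 0 ≤ k y) ∧ (∫ y, k y = 1) ∧ (∀ y, k y ≠ 0 → Literature.Analysis.FluidPDE.Torus.euclidDist y 0 < ℓ)) → ∀ᶠ N in Filter.atTop, ∀ D : Literature.Analysis.FluidPDE.Config (N + 1) (Fin 3) Literature.MathematicalPhysics.KineticTheory.T3 → ℝ, D = (fun z => (∫ s in t₁..t₂, ∫ x, ((N + 1 : ℕ) : ℝ)⁻¹ * ∑ a, k (x - ((Φ N).flow s z a).1) * ((∑ i, ((Φ N).flow s z a).2 i * Literature.Analysis.FunctionSpaces.Torus.partialDeriv i ψ x) * (‖((Φ N).flow s z a).2‖ ^ 2 / 2))) - (∫ s in t₁..t₂, ∫ x, (((Literature.MathematicalPhysics.KineticTheory.empiricalEnergyField ((Φ N).flow s z) (fun y => k (x - y)) + Literature.MathematicalPhysics.KineticTheory.empiricalDensityField ((Φ N).flow s z) (fun y => k (x - y)) * (2 / 3 * (Literature.MathematicalPhysics.KineticTheory.empiricalEnergyField ((Φ N).flow s z) (fun y => k (x - y)) / Literature.MathematicalPhysics.KineticTheory.empiricalDensityField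 ((Φ N).flow s z) (fun y => k (x - y)) - ‖Literature.MathematicalPhysics.KineticTheory.empiricalMomentumField ((Φ N).flow s z) (fun y => k (x - y))‖ ^ 2 / (2 * Literature.MathematicalPhysics.KineticTheory.empiricalDensityField ((Φ N).flow s z) (fun y => k (x - y)) ^ 2)))) / Literature.MathematicalPhysics.KineticTheory.empiricalDensityField ((Φ N).flow s z) (fun y => k (x - y))) * (∑ i, Literature.MathematicalPhysics.KineticTheory.empiricalMomentumField ((Φ N).flow s z) (fun y => k (x - y)) i * Literature.Analysis.FunctionSpaces.Torus.partialDeriv i ψ x)))) → MeasureTheory.Integrable D (Literature.MathematicalPhysics.KineticTheory.localGibbsLaw σ a₀ u₀ θ₀ N (Φ N)) ∧ |∫ z, D z ∂Literature.MathematicalPhysics.KineticTheory.localGibbsLaw σ a₀ u₀ θ₀ N (Φ N)| ≤ ε) :=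
  Summit.AtomisticToContinuum.HydrodynamicLimit.Theorems.stub_idealEnergyCurrentClosure_of_heatFluxClosure stub_scaleHeatFluxClosure

/-- stub CE' — MEAN COLLISIONAL ENERGY-CURRENT CLOSURE IN CONTACT FORM (OPEN; carries the EOS). Same prefix as
the crux; eventually in N `z ↦ c W^{contact}_ψ(z) + J^e_ψ(z) − I^e_ψ(z)` is integrable with |expectation| ≤ ε, where
`W^{contact}_ψ = Σ_{t_c ∈ (t₁,t₂]} Σ_{(i,j) colliding} ½ Dψ(x_i)(x_i ⊖ x_j) ΔE_i` (Literature
`HardSphereFlow.collisionalTransferFunctional` of the time-t₁ point over `(0, t₂−t₁]` with the CONTACT kernel; per collision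
`½(Dψ(x_i)+Dψ(x_j))(n) ΔE_i`, `ΔE_i = ⟪V, Δv_i⟫`): the collisional energy transfer with its O(σ_N) Taylor remainder
REMOVED (landed: `…Theorems.stub_collisionalEnergyContactRemainder`, p148524; glue
`flux_contact_imply_collisionalEnergyCurrentClosure` below restores stub CE from FLUX + CE'). The claim is the closure in
mean of the contact energy current on the excess-pressure work `∫∫ ρ^kθ^k(Z(ρ^kσ³) − 1) u^k·∇ψ` — (D1) + the EOS caveat
of stub CS. Leans on: `HardSphereFlow.collisionalTransferFunctional`, `Torus.fderiv`, `hsPressure`, empirical fields,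
`localGibbsLaw`. -/
theorem stub_collisionalEnergyContactClosure : ∀ (a₀ θ₀ : Literature.MathematicalPhysics.KineticTheory.T3 → ℝ) (u₀ : Literature.MathematicalPhysics.KineticTheory.T3 → Literature.MathematicalPhysics.KineticTheory.V3), Continuous a₀ → Continuous θ₀ → Continuous u₀ → (∀ x, 0 < a₀ x) → (∀ x, 0 < θ₀ x) → ∃ σ₀ : ℝ, 0 < σ₀ ∧ ∀ σ : ℝ, 0 < σ → σ < σ₀ → ∀ Φ : (N : ℕ) → Literature.Analysis.FluidPDE.HardSphereFlow (Literature.Analysis.FluidPDE.Torus.geometry (Fin 3)) (Literature.MathematicalPhysics.KineticTheory.hsDiameter σ N) (N + 1), ∀ t₁ t₂ : ℝ, 0 ≤ t₁ → t₁ ≤ t₂ → ∀ ε : ℝ, 0 < ε → (∀ ψ : Literature.MathematicalPhysics.KineticTheory.T3 → ℝ, Literature.Analysis.FunctionSpaces.Torus.IsSmooth ψ → ∃ ℓ : ℝ, 0 < ℓ ∧ ∀ k : Literature.MathematicalPhysics.KineticTheory.T3 → ℝ, (Continuous k ∧ (∀ y, 0 ≤ k y) ∧ (∫ y, k y = 1)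 ∧ (∀ y, k y ≠ 0 → Literature.Analysis.FluidPDE.Torus.euclidDist y 0 < ℓ)) → ∀ᶠ N in Filter.atTop, ∀ D : Literature.Analysis.FluidPDE.Config (N + 1) (Fin 3) Literature.MathematicalPhysics.KineticTheory.T3 → ℝ, D = (fun z => ((N + 1 : ℕ) : ℝ)⁻¹ * (Φ N).collisionalTransferFunctional (fun (i j : Fin (N + 1)) (pre post : Literature.Analysis.FluidPDE.Config (N + 1) (Fin 3) Literature.MathematicalPhysics.KineticTheory.T3) => 2⁻¹ * (Literature.Analysis.FunctionSpaces.Torus.fderiv ψ (post i).1 ((Literature.Analysis.FluidPDE.Torus.geometry (Fin 3)).sepVec (post i).1 (post j).1) * ((‖(post i).2‖ ^ 2 - ‖(pre i).2‖ ^ 2) / 2))) ((Φ N).flow t₁ z) (t₂ - t₁) + (∫ s in t₁..t₂, ∫ x, (((Literature.MathematicalPhysics.KineticTheory.empiricalEnergyField ((Φ N).flow s z) (fun y => k (x - y)) + Literature.MathematicalPhysics.KineticTheory.empiricalDensityField ((Φ N).flow s z) (fun y => k (x - y)) * (2 / 3 * (Literature.MathematicalPhysics.KineticTheory.empiricalEnergyField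 ((Φ N).flow s z) (fun y => k (x - y)) / Literature.MathematicalPhysics.KineticTheory.empiricalDensityField ((Φ N).flow s z) (fun y => k (x - y)) - ‖Literature.MathematicalPhysics.KineticTheory.empiricalMomentumField ((Φ N).flow s z) (fun y => k (x - y))‖ ^ 2 / (2 * Literature.MathematicalPhysics.KineticTheory.empiricalDensityField ((Φ N).flow s z) (fun y => k (x - y)) ^ 2)))) / Literature.MathematicalPhysics.KineticTheory.empiricalDensityField ((Φ N).flow s z) (fun y => k (x - y))) * (∑ i, Literature.MathematicalPhysics.KineticTheory.empiricalMomentumField ((Φ N).flow s z) (fun y => k (x - y)) i * Literature.Analysis.FunctionSpaces.Torus.partialDeriv i ψ x))) - (∫ s in t₁..t₂, ∫ x, (((Literature.MathematicalPhysics.KineticTheory.empiricalEnergyField ((Φ N).flow s z) (fun y => k (x - y)) + Literature.MathematicalPhysics.KineticTheory.hsPressure σ (Literature.MathematicalPhysics.KineticTheory.empiricalDensityField ((Φ N).flow s z) (fun y => k (x - y))) (2 / 3 * (Literature.MathematicalPhysics.KineticTheory.empiricalEnergyField ((Φ N).flow s z) (fun y => k (x - y)) / Literature.MathematicalPhysics.KineticTheory.empiricalDensityField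 ((Φ N).flow s z) (fun y => k (x - y)) - ‖Literature.MathematicalPhysics.KineticTheory.empiricalMomentumField ((Φ N).flow s z) (fun y => k (x - y))‖ ^ 2 / (2 * Literature.MathematicalPhysics.KineticTheory.empiricalDensityField ((Φ N).flow s z) (fun y => k (x - y)) ^ 2)))) / Literature.MathematicalPhysics.KineticTheory.empiricalDensityField ((Φ N).flow s z) (fun y => k (x - y))) * (∑ i, Literature.MathematicalPhysics.KineticTheory.empiricalMomentumField ((Φ N).flow s z) (fun y => k (x - y)) i * Literature.Analysis.FunctionSpaces.Torus.partialDeriv i ψ x)))) → MeasureTheory.Integrable D (Literature.MathematicalPhysics.KineticTheory.localGibbsLaw σ a₀ u₀ θ₀ N (Φ N)) ∧ |∫ z, D z ∂Literature.MathematicalPhysics.KineticTheory.localGibbsLaw σ a₀ u₀ θ₀ N (Φ N)| ≤ ε) := by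
  sorry

/-! ## Pathwise bookkeeping (sorry-free) -/

variable {n : ℕ}

/-- The momentum defect's boundary term in the route's vocabulary is the momentum observable:
`Σᵢ ⟨m_n, φᵢ⟩ᵢ = n⁻¹ Σ_a ⟪φ(x_a), v_a⟫`. [folklore] -/
theorem sum_empiricalMomentumField_apply_eq (z : Config n (Fin 3) T3) (φ : T3 → V3) :
    ∑ i, (empiricalMomentumField z (fun y => φ y i)) i = (n : ℝ)⁻¹ * momentumObservable φ z := by
  have h1 : ∀ i, (empiricalMomentumField z (fun y => φ y i)) i =
      (n : ℝ)⁻¹ * ∑ a, φ (z a).1 i * (z a).2 i := by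
    intro i
    simp only [empiricalMomentumField_eq_sum, PiLp.smul_apply, WithLp.ofLp_sum,
      Finset.sum_apply, smul_eq_mul, WithLp.ofLp_smul, Pi.smul_apply]
  have h2 : momentumObservable φ z = ∑ a, ∑ i, φ (z a).1 i * (z a).2 i := by
    simp only [momentumObservable, PiLp.inner_apply, RCLike.inner_apply, conj_trivial]
    exact Finset.sum_congr rfl fun a _ => Finset.sum_congr rfl fun i _ => mul_comm _ _
  simp only [h1, h2]
  rw [← Finset.mul_sum, Finset.sum_comm]

/-- The energy defect's boundary term is the energy observable:
`⟨E_n, ψ⟩ = n⁻¹ Σ_a ψ(x_a) |v_a|²/2`. [folklore] -/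
theorem empiricalEnergyField_eq_energyObservable (z : Config n (Fin 3) T3) (ψ : T3 → ℝ) :
    empiricalEnergyField z ψ = (n : ℝ)⁻¹ * energyObservable ψ z := by
  simp only [empiricalEnergyField_eq_sum, energyObservable]

/-- **Pathwise momentum balance over `[t₁, t₂]`** on the good set: for a `C¹` field `φ`,
`Σ_a⟪φ(x_a(t₂)),v_a(t₂)⟫ − Σ_a⟪φ(x_a(t₁)),v_a(t₁)⟫ = ∫_{t₁}^{t₂} Σ_a⟪Dφ(x_a)v_a,v_a⟫ ds + W_φ`
with `W_φ` the collisional momentum transfer of the time-`t₁` point over `(0, t₂ − t₁]`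
(`HardSphereFlow.momentumObservable_sub_eq_torus` transported by the group law). [folklore] -/
theorem momentumObservable_flow_sub_flow {ε : ℝ} (Φ : HardSphereFlow (Torus.geometry (Fin 3)) ε n)
    {φ : T3 → V3} (hφ : Torus.IsContDiff 1 φ) {z : Config n (Fin 3) T3} (hz : z ∈ Φ.good)
    {t₁ t₂ : ℝ} (h : t₁ ≤ t₂) :
    momentumObservable φ (Φ.flow t₂ z) - momentumObservable φ (Φ.flow t₁ z) =
      (∫ s in t₁..t₂, momentumStreaming φ (Φ.flow s z)) + Φ.momentumTransfer φ (Φ.flow t₁ z) (t₂ - t₁) := by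
  have hz₁ : Φ.flow t₁ z ∈ Φ.good := Φ.mapsTo_good t₁ hz
  obtain ⟨-, H⟩ := Φ.momentumObservable_sub_eq_torus hφ hz₁ (sub_nonneg.2 h)
  have hshift : ∀ s, Φ.flow s (Φ.flow t₁ z) = Φ.flow (s + t₁) z := fun s => (Φ.flow_add s t₁ z hz).symm
  simp only [hshift, sub_add_cancel] at H
  rw [H, intervalIntegral.integral_comp_add_right (fun s => momentumStreaming φ (Φ.flow s z)) t₁]
  simp

/-- **Pathwise energy balance over `[t₁, t₂]`** on the good set (energy twin of
`momentumObservable_flow_sub_flow`). [folklore] -/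
theorem energyObservable_flow_sub_flow {ε : ℝ} (Φ : HardSphereFlow (Torus.geometry (Fin 3)) ε n)
    {ψ : T3 → ℝ} (hψ : Torus.IsContDiff 1 ψ) {z : Config n (Fin 3) T3} (hz : z ∈ Φ.good)
    {t₁ t₂ : ℝ} (h : t₁ ≤ t₂) :
    energyObservable ψ (Φ.flow t₂ z) - energyObservable ψ (Φ.flow t₁ z) =
      (∫ s in t₁..t₂, energyStreaming ψ (Φ.flow s z)) + Φ.energyTransfer ψ (Φ.flow t₁ z) (t₂ - t₁) := by
  have hz₁ : Φ.flow t₁ z ∈ Φ.good := Φ.mapsTo_good t₁ hz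
  obtain ⟨-, H⟩ := Φ.energyObservable_sub_eq_torus hψ hz₁ (sub_nonneg.2 h)
  have hshift : ∀ s, Φ.flow s (Φ.flow t₁ z) = Φ.flow (s + t₁) z := fun s => (Φ.flow_add s t₁ z hz).symm
  simp only [hshift, sub_add_cancel] at H
  rw [H, intervalIntegral.integral_comp_add_right (fun s => energyStreaming ψ (Φ.flow s z)) t₁]
  simp

/-- The good set of the flow is conull for the local Gibbs law (absolute continuity with respect to
the Liouville measure). [folklore] -/
theorem ae_mem_good_localGibbsLaw (σ : ℝ) (a₀ : T3 → ℝ) (u₀ : T3 → V3) (θ₀ : T3 → ℝ) (N : ℕ)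
    (Φ : HardSphereFlow (Torus.geometry (Fin 3)) (hsDiameter σ N) (N + 1)) :
    ∀ᵐ z ∂localGibbsLaw σ a₀ u₀ θ₀ N Φ, z ∈ Φ.good := by
  rw [localGibbsLaw_eq]
  exact (localGibbsMeasure_absolutelyContinuous σ a₀ u₀ θ₀ N Φ).ae_le Φ.ae_mem_good

/-- Abstract assembly of two mean-defect bounds: if `D = F₁ + F₂` almost surely and each `Fᵢ` is
integrable with `|E Fᵢ| ≤ ε/2`, then `D` is integrable with `|E D| ≤ ε`. [folklore] -/
theorem integrable_and_abs_integral_le_of_ae_eq_add {α : Type*} [MeasurableSpace α] {μ : Measure α}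
    {D F₁ F₂ : α → ℝ} {ε : ℝ} (hae : D =ᵐ[μ] fun z => F₁ z + F₂ z)
    (h₁ : Integrable F₁ μ ∧ |∫ z, F₁ z ∂μ| ≤ ε / 2) (h₂ : Integrable F₂ μ ∧ |∫ z, F₂ z ∂μ| ≤ ε / 2) :
    Integrable D μ ∧ |∫ z, D z ∂μ| ≤ ε := by
  refine ⟨(h₁.1.add h₂.1).congr hae.symm, ?_⟩
  rw [integral_congr_ae hae, integral_add h₁.1 h₂.1]
  calc |(∫ z, F₁ z ∂μ) + ∫ z, F₂ z ∂μ| ≤ |∫ z, F₁ z ∂μ| + |∫ z, F₂ z ∂μ| := abs_add_le _ _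
    _ ≤ ε / 2 + ε / 2 := add_le_add h₁.2 h₂.2
    _ = ε := add_halves ε

/-- A kernel supported in the `min ℓ₁ ℓ₂`-ball is supported in the `ℓ₁`- and in the `ℓ₂`-ball. [folklore] -/
theorem kernel_mono {k : T3 → ℝ} {ℓ ℓ' : ℝ} (hℓ : ℓ ≤ ℓ')
    (hk : Continuous k ∧ (∀ y, 0 ≤ k y) ∧ (∫ y, k y = 1) ∧ (∀ y, k y ≠ 0 → Torus.euclidDist y 0 < ℓ)) :
    Continuous k ∧ (∀ y, 0 ≤ k y) ∧ (∫ y, k y = 1) ∧ (∀ y, k y ≠ 0 → Torus.euclidDist y 0 < ℓ') :=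
  ⟨hk.1, hk.2.1, hk.2.2.1, fun y hy => (hk.2.2.2 y hy).trans_le hℓ⟩

/-! ## The glue as propositions (signatures verbatim) -/

/-- Signature of stub KS-a as a named proposition (verbatim). -/
def StreamingStressCommutator : Prop := ∀ (a₀ θ₀ : Literature.MathematicalPhysics.KineticTheory.T3 → ℝ) (u₀ : Literature.MathematicalPhysics.KineticTheory.T3 → Literature.MathematicalPhysics.KineticTheory.V3), Continuous a₀ → Continuous θ₀ → Continuous u₀ → (∀ x, 0 < a₀ x) → (∀ x, 0 < θ₀ x) → ∃ σ₀ : ℝ, 0 < σ₀ ∧ ∀ σ : ℝ, 0 < σ → σ < σ₀ → ∀ Φ : (N : ℕ) → Literature.Analysis.FluidPDE.HardSphereFlow (Literature.Analysis.FluidPDE.Torus.geometry (Fin 3)) (Literature.MathematicalPhysics.KineticTheory.hsDiameter σ N) (N + 1), ∀ t₁ t₂ : ℝ, 0 ≤ t₁ → t₁ ≤ t₂ → ∀ ε : ℝ, 0 < ε → (∀ φ : Literature.MathematicalPhysics.KineticTheory.T3 → Literature.MathematicalPhysics.KineticTheory.V3, Literature.Analysis.FunctionSpaces.Torus.IsSmooth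 φ → ∃ ℓ : ℝ, 0 < ℓ ∧ ∀ k : Literature.MathematicalPhysics.KineticTheory.T3 → ℝ, (Continuous k ∧ (∀ y, 0 ≤ k y) ∧ (∫ y, k y = 1) ∧ (∀ y, k y ≠ 0 → Literature.Analysis.FluidPDE.Torus.euclidDist y 0 < ℓ)) → ∀ᶠ N in Filter.atTop, ∀ D : Literature.Analysis.FluidPDE.Config (N + 1) (Fin 3) Literature.MathematicalPhysics.KineticTheory.T3 → ℝ, D = (fun z => ((N + 1 : ℕ) : ℝ)⁻¹ * (∫ s in t₁..t₂, Literature.Analysis.FluidPDE.momentumStreaming φ ((Φ N).flow s z)) - ∫ s in t₁..t₂, ∫ x, ((N + 1 : ℕ) : ℝ)⁻¹ * ∑ a, k (x - ((Φ N).flow s z a).1) * (∑ i, ∑ j, ((Φ N).flow s z a).2 i * ((Φ N).flow s z a).2 j * Literature.Analysis.FunctionSpaces.Torus.partialDeriv j (fun y => φ y i) x)) → MeasureTheory.Integrable D (Literature.MathematicalPhysics.KineticTheory.localGibbsLaw σ a₀ u₀ θ₀ N (Φ N)) ∧ |∫ z, D z ∂Literature.MathematicalPhysics.KineticTheory.localGibbsLaw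 σ a₀ u₀ θ₀ N (Φ N)| ≤ ε)

/-- Signature of stub KS-b as a named proposition (verbatim). -/
def DeviatoricStressClosure : Prop := ∀ (a₀ θ₀ : Literature.MathematicalPhysics.KineticTheory.T3 → ℝ) (u₀ : Literature.MathematicalPhysics.KineticTheory.T3 → Literature.MathematicalPhysics.KineticTheory.V3), Continuous a₀ → Continuous θ₀ → Continuous u₀ → (∀ x, 0 < a₀ x) → (∀ x, 0 < θ₀ x) → ∃ σ₀ : ℝ, 0 < σ₀ ∧ ∀ σ : ℝ, 0 < σ → σ < σ₀ → ∀ Φ : (N : ℕ) → Literature.Analysis.FluidPDE.HardSphereFlow (Literature.Analysis.FluidPDE.Torus.geometry (Fin 3)) (Literature.MathematicalPhysics.KineticTheory.hsDiameter σ N) (N + 1), ∀ t₁ t₂ : ℝ, 0 ≤ t₁ → t₁ ≤ t₂ → ∀ ε : ℝ, 0 < ε → (∀ φ : Literature.MathematicalPhysics.KineticTheory.T3 → Literature.MathematicalPhysics.KineticTheory.V3, Literature.Analysis.FunctionSpaces.Torus.IsSmooth φ → ∃ ℓ : ℝ, 0 < ℓ ∧ ∀ k : Literature.MathematicalPhysics.KineticTheory.T3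 → ℝ, (Continuous k ∧ (∀ y, 0 ≤ k y) ∧ (∫ y, k y = 1) ∧ (∀ y, k y ≠ 0 → Literature.Analysis.FluidPDE.Torus.euclidDist y 0 < ℓ)) → ∀ᶠ N in Filter.atTop, ∀ D : Literature.Analysis.FluidPDE.Config (N + 1) (Fin 3) Literature.MathematicalPhysics.KineticTheory.T3 → ℝ, D = (fun z => (∫ s in t₁..t₂, ∫ x, ((N + 1 : ℕ) : ℝ)⁻¹ * ∑ a, k (x - ((Φ N).flow s z a).1) * (∑ i, ∑ j, ((Φ N).flow s z a).2 i * ((Φ N).flow s z a).2 j * Literature.Analysis.FunctionSpaces.Torus.partialDeriv j (fun y => φ y i) x)) - (∫ s in t₁..t₂, ∫ x, ((∑ i, ∑ j, (Literature.MathematicalPhysics.KineticTheory.empiricalMomentumField ((Φ N).flow s z) (fun y => k (x - y)) i * Literature.MathematicalPhysics.KineticTheory.empiricalMomentumField ((Φ N).flow s z) (fun y => k (x - y)) j / Literature.MathematicalPhysics.KineticTheory.empiricalDensityField ((Φ N).flow s z) (fun y => k (x - y))) * Literature.Analysis.FunctionSpaces.Torus.partialDeriv j (fun y => φ y i) x)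 + Literature.MathematicalPhysics.KineticTheory.empiricalDensityField ((Φ N).flow s z) (fun y => k (x - y)) * (2 / 3 * (Literature.MathematicalPhysics.KineticTheory.empiricalEnergyField ((Φ N).flow s z) (fun y => k (x - y)) / Literature.MathematicalPhysics.KineticTheory.empiricalDensityField ((Φ N).flow s z) (fun y => k (x - y)) - ‖Literature.MathematicalPhysics.KineticTheory.empiricalMomentumField ((Φ N).flow s z) (fun y => k (x - y))‖ ^ 2 / (2 * Literature.MathematicalPhysics.KineticTheory.empiricalDensityField ((Φ N).flow s z) (fun y => k (x - y)) ^ 2))) * Literature.Analysis.FunctionSpaces.Torus.divergence φ x))) → MeasureTheory.Integrable D (Literature.MathematicalPhysics.KineticTheory.localGibbsLaw σ a₀ u₀ θ₀ N (Φ N)) ∧ |∫ z, D z ∂Literature.MathematicalPhysics.KineticTheory.localGibbsLaw σ a₀ u₀ θ₀ N (Φ N)| ≤ ε)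

/-- Mean kinetic-stress closure (KS = KS-a + KS-b): the time-integrated kinetic stress tested with ∇φ
closes in mean on the ideal Euler stress of the mollified fields (verbatim signature). -/
def KineticStressClosure : Prop := ∀ (a₀ θ₀ : Literature.MathematicalPhysics.KineticTheory.T3 → ℝ) (u₀ : Literature.MathematicalPhysics.KineticTheory.T3 → Literature.MathematicalPhysics.KineticTheory.V3), Continuous a₀ → Continuous θ₀ → Continuous u₀ → (∀ x, 0 < a₀ x) → (∀ x, 0 < θ₀ x) → ∃ σ₀ : ℝ, 0 < σ₀ ∧ ∀ σ : ℝ, 0 < σ → σ < σ₀ → ∀ Φ : (N : ℕ) → Literature.Analysis.FluidPDE.HardSphereFlow (Literature.Analysis.FluidPDE.Torus.geometry (Fin 3)) (Literature.MathematicalPhysics.KineticTheory.hsDiameter σ N) (N + 1), ∀ t₁ t₂ : ℝ, 0 ≤ t₁ → t₁ ≤ t₂ → ∀ ε : ℝ, 0 < ε → (∀ φ : Literature.MathematicalPhysics.KineticTheory.T3 → Literature.MathematicalPhysics.KineticTheory.V3, Literature.Analysis.FunctionSpaces.Torus.IsSmooth φ → ∃ ℓ : ℝ, 0 < ℓ ∧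 ∀ k : Literature.MathematicalPhysics.KineticTheory.T3 → ℝ, (Continuous k ∧ (∀ y, 0 ≤ k y) ∧ (∫ y, k y = 1) ∧ (∀ y, k y ≠ 0 → Literature.Analysis.FluidPDE.Torus.euclidDist y 0 < ℓ)) → ∀ᶠ N in Filter.atTop, ∀ D : Literature.Analysis.FluidPDE.Config (N + 1) (Fin 3) Literature.MathematicalPhysics.KineticTheory.T3 → ℝ, D = (fun z => ((N + 1 : ℕ) : ℝ)⁻¹ * (∫ s in t₁..t₂, Literature.Analysis.FluidPDE.momentumStreaming φ ((Φ N).flow s z)) - ∫ s in t₁..t₂, ∫ x, ((∑ i, ∑ j, (Literature.MathematicalPhysics.KineticTheory.empiricalMomentumField ((Φ N).flow s z) (fun y => k (x - y)) i * Literature.MathematicalPhysics.KineticTheory.empiricalMomentumField ((Φ N).flow s z) (fun y => k (x - y)) j / Literature.MathematicalPhysics.KineticTheory.empiricalDensityField ((Φ N).flow s z) (fun y => k (x - y))) * Literature.Analysis.FunctionSpaces.Torus.partialDeriv j (fun y => φ y i) x) + Literature.MathematicalPhysics.KineticTheory.empiricalDensityField ((Φ N).flow s z) (fun y => k (x - y))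 * (2 / 3 * (Literature.MathematicalPhysics.KineticTheory.empiricalEnergyField ((Φ N).flow s z) (fun y => k (x - y)) / Literature.MathematicalPhysics.KineticTheory.empiricalDensityField ((Φ N).flow s z) (fun y => k (x - y)) - ‖Literature.MathematicalPhysics.KineticTheory.empiricalMomentumField ((Φ N).flow s z) (fun y => k (x - y))‖ ^ 2 / (2 * Literature.MathematicalPhysics.KineticTheory.empiricalDensityField ((Φ N).flow s z) (fun y => k (x - y)) ^ 2))) * Literature.Analysis.FunctionSpaces.Torus.divergence φ x)) → MeasureTheory.Integrable D (Literature.MathematicalPhysics.KineticTheory.localGibbsLaw σ a₀ u₀ θ₀ N (Φ N)) ∧ |∫ z, D z ∂Literature.MathematicalPhysics.KineticTheory.localGibbsLaw σ a₀ u₀ θ₀ N (Φ N)| ≤ ε)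

/-- Signature of stub CS as a named proposition (verbatim). -/
def CollisionalStressClosure : Prop := ∀ (a₀ θ₀ : Literature.MathematicalPhysics.KineticTheory.T3 → ℝ) (u₀ : Literature.MathematicalPhysics.KineticTheory.T3 → Literature.MathematicalPhysics.KineticTheory.V3), Continuous a₀ → Continuous θ₀ → Continuous u₀ → (∀ x, 0 < a₀ x) → (∀ x, 0 < θ₀ x) → ∃ σ₀ : ℝ, 0 < σ₀ ∧ ∀ σ : ℝ, 0 < σ → σ < σ₀ → ∀ Φ : (N : ℕ) → Literature.Analysis.FluidPDE.HardSphereFlow (Literature.Analysis.FluidPDE.Torus.geometry (Fin 3)) (Literature.MathematicalPhysics.KineticTheory.hsDiameter σ N) (N + 1), ∀ t₁ t₂ : ℝ, 0 ≤ t₁ → t₁ ≤ t₂ → ∀ ε : ℝ, 0 < ε → (∀ φ : Literature.MathematicalPhysics.KineticTheory.T3 → Literature.MathematicalPhysics.KineticTheory.V3, Literature.Analysis.FunctionSpaces.Torus.IsSmooth φ → ∃ ℓ : ℝ, 0 < ℓ ∧ ∀ k : Literature.MathematicalPhysics.KineticTheory.T3 → ℝ, (Continuous k ∧ (∀ y,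 0 ≤ k y) ∧ (∫ y, k y = 1) ∧ (∀ y, k y ≠ 0 → Literature.Analysis.FluidPDE.Torus.euclidDist y 0 < ℓ)) → ∀ᶠ N in Filter.atTop, ∀ D : Literature.Analysis.FluidPDE.Config (N + 1) (Fin 3) Literature.MathematicalPhysics.KineticTheory.T3 → ℝ, D = (fun z => ((N + 1 : ℕ) : ℝ)⁻¹ * (Φ N).momentumTransfer φ ((Φ N).flow t₁ z) (t₂ - t₁) + (∫ s in t₁..t₂, ∫ x, ((∑ i, ∑ j, (Literature.MathematicalPhysics.KineticTheory.empiricalMomentumField ((Φ N).flow s z) (fun y => k (x - y)) i * Literature.MathematicalPhysics.KineticTheory.empiricalMomentumField ((Φ N).flow s z) (fun y => k (x - y)) j / Literature.MathematicalPhysics.KineticTheory.empiricalDensityField ((Φ N).flow s z) (fun y => k (x - y))) * Literature.Analysis.FunctionSpaces.Torus.partialDeriv j (fun y => φ y i) x) + Literature.MathematicalPhysics.KineticTheory.empiricalDensityField ((Φ N).flow s z) (fun y => k (x - y)) * (2 / 3 * (Literature.MathematicalPhysics.KineticTheory.empiricalEnergyField ((Φ N).flow s z) (fun y => k (x - y))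 / Literature.MathematicalPhysics.KineticTheory.empiricalDensityField ((Φ N).flow s z) (fun y => k (x - y)) - ‖Literature.MathematicalPhysics.KineticTheory.empiricalMomentumField ((Φ N).flow s z) (fun y => k (x - y))‖ ^ 2 / (2 * Literature.MathematicalPhysics.KineticTheory.empiricalDensityField ((Φ N).flow s z) (fun y => k (x - y)) ^ 2))) * Literature.Analysis.FunctionSpaces.Torus.divergence φ x)) - (∫ s in t₁..t₂, ∫ x, ((∑ i, ∑ j, (Literature.MathematicalPhysics.KineticTheory.empiricalMomentumField ((Φ N).flow s z) (fun y => k (x - y)) i * Literature.MathematicalPhysics.KineticTheory.empiricalMomentumField ((Φ N).flow s z) (fun y => k (x - y)) j / Literature.MathematicalPhysics.KineticTheory.empiricalDensityField ((Φ N).flow s z) (fun y => k (x - y))) * Literature.Analysis.FunctionSpaces.Torus.partialDeriv j (fun y => φ y i) x) + Literature.MathematicalPhysics.KineticTheory.hsPressure σ (Literature.MathematicalPhysics.KineticTheory.empiricalDensityField ((Φ N).flow s z) (fun y => k (x - y))) (2 / 3 * (Literature.MathematicalPhysics.KineticTheory.empiricalEnergyField ((Φ N).flow s z) (fun y => k (x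 - y)) / Literature.MathematicalPhysics.KineticTheory.empiricalDensityField ((Φ N).flow s z) (fun y => k (x - y)) - ‖Literature.MathematicalPhysics.KineticTheory.empiricalMomentumField ((Φ N).flow s z) (fun y => k (x - y))‖ ^ 2 / (2 * Literature.MathematicalPhysics.KineticTheory.empiricalDensityField ((Φ N).flow s z) (fun y => k (x - y)) ^ 2))) * Literature.Analysis.FunctionSpaces.Torus.divergence φ x))) → MeasureTheory.Integrable D (Literature.MathematicalPhysics.KineticTheory.localGibbsLaw σ a₀ u₀ θ₀ N (Φ N)) ∧ |∫ z, D z ∂Literature.MathematicalPhysics.KineticTheory.localGibbsLaw σ a₀ u₀ θ₀ N (Φ N)| ≤ ε)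

/-- Signature of stub FLUX-RS as a named proposition (verbatim). -/
def RelSpeedCollisionMeanBound : Prop := ∀ (a₀ θ₀ : Literature.MathematicalPhysics.KineticTheory.T3 → ℝ) (u₀ : Literature.MathematicalPhysics.KineticTheory.T3 → Literature.MathematicalPhysics.KineticTheory.V3), Continuous a₀ → Continuous θ₀ → Continuous u₀ → (∀ x, 0 < a₀ x) → (∀ x, 0 < θ₀ x) → ∃ σ₀ : ℝ, 0 < σ₀ ∧ ∀ σ : ℝ, 0 < σ → σ < σ₀ → ∀ Φ : (N : ℕ) → Literature.Analysis.FluidPDE.HardSphereFlow (Literature.Analysis.FluidPDE.Torus.geometry (Fin 3)) (Literature.MathematicalPhysics.KineticTheory.hsDiameter σ N) (N + 1), ∀ t₁ t₂ : ℝ, 0 ≤ t₁ → t₁ ≤ t₂ → ∃ C : ℝ, ∀ᶠ N in Filter.atTop, ∀ Q : Literature.Analysis.FluidPDE.Config (N + 1) (Fin 3) Literature.MathematicalPhysics.KineticTheory.T3 → ℝ, Q = (fun z => Literature.MathematicalPhysics.KineticTheory.hsDiameter σ N * ((N + 1 : ℕ) : ℝ)⁻¹ * (Φ N).collisionalTransferFunctional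 (fun (i j : Fin (N + 1)) (pre _post : Literature.Analysis.FluidPDE.Config (N + 1) (Fin 3) Literature.MathematicalPhysics.KineticTheory.T3) => ‖(pre i).2 - (pre j).2‖) ((Φ N).flow t₁ z) (t₂ - t₁)) → MeasureTheory.Integrable Q (Literature.MathematicalPhysics.KineticTheory.localGibbsLaw σ a₀ u₀ θ₀ N (Φ N)) ∧ ∫ z, Q z ∂Literature.MathematicalPhysics.KineticTheory.localGibbsLaw σ a₀ u₀ θ₀ N (Φ N) ≤ C

/-- Signature of stub VIRIAL as a named proposition (verbatim). -/
def CollisionalVirialClosure : Prop := ∀ (a₀ θ₀ : Literature.MathematicalPhysics.KineticTheory.T3 → ℝ) (u₀ : Literature.MathematicalPhysics.KineticTheory.T3 → Literature.MathematicalPhysics.KineticTheory.V3), Continuous a₀ → Continuous θ₀ → Continuous u₀ → (∀ x, 0 < a₀ x) → (∀ x, 0 < θ₀ x) → ∃ σ₀ : ℝ, 0 < σ₀ ∧ ∀ σ : ℝ, 0 < σ → σ < σ₀ → ∀ Φ : (N : ℕ) → Literature.Analysis.FluidPDE.HardSphereFlow (Literature.Analysis.FluidPDE.Torus.geometry (Fin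 3)) (Literature.MathematicalPhysics.KineticTheory.hsDiameter σ N) (N + 1), ∀ t₁ t₂ : ℝ, 0 ≤ t₁ → t₁ ≤ t₂ → ∀ ε : ℝ, 0 < ε → (∀ φ : Literature.MathematicalPhysics.KineticTheory.T3 → Literature.MathematicalPhysics.KineticTheory.V3, Literature.Analysis.FunctionSpaces.Torus.IsSmooth φ → ∃ ℓ : ℝ, 0 < ℓ ∧ ∀ k : Literature.MathematicalPhysics.KineticTheory.T3 → ℝ, (Continuous k ∧ (∀ y, 0 ≤ k y) ∧ (∫ y, k y = 1) ∧ (∀ y, k y ≠ 0 → Literature.Analysis.FluidPDE.Torus.euclidDist y 0 < ℓ)) → ∀ᶠ N in Filter.atTop, ∀ D : Literature.Analysis.FluidPDE.Config (N + 1) (Fin 3) Literature.MathematicalPhysics.KineticTheory.T3 → ℝ, D = (fun z => ((N + 1 : ℕ) : ℝ)⁻¹ * (Φ N).collisionalStress (Literature.Analysis.FunctionSpaces.Torus.fderiv φ) ((Φ N).flow t₁ z) (t₂ - t₁) + (∫ s in t₁..t₂, ∫ x, ((∑ i, ∑ j, (Literature.MathematicalPhysics.KineticTheory.empiricalMomentumField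 ((Φ N).flow s z) (fun y => k (x - y)) i * Literature.MathematicalPhysics.KineticTheory.empiricalMomentumField ((Φ N).flow s z) (fun y => k (x - y)) j / Literature.MathematicalPhysics.KineticTheory.empiricalDensityField ((Φ N).flow s z) (fun y => k (x - y))) * Literature.Analysis.FunctionSpaces.Torus.partialDeriv j (fun y => φ y i) x) + Literature.MathematicalPhysics.KineticTheory.empiricalDensityField ((Φ N).flow s z) (fun y => k (x - y)) * (2 / 3 * (Literature.MathematicalPhysics.KineticTheory.empiricalEnergyField ((Φ N).flow s z) (fun y => k (x - y)) / Literature.MathematicalPhysics.KineticTheory.empiricalDensityField ((Φ N).flow s z) (fun y => k (x - y)) - ‖Literature.MathematicalPhysics.KineticTheory.empiricalMomentumField ((Φ N).flow s z) (fun y => k (x - y))‖ ^ 2 / (2 * Literature.MathematicalPhysics.KineticTheory.empiricalDensityField ((Φ N).flow s z) (fun y => k (x - y)) ^ 2))) * Literature.Analysis.FunctionSpaces.Torus.divergence φ x)) - (∫ s in t₁..t₂, ∫ x, ((∑ i, ∑ j, (Literature.MathematicalPhysics.KineticTheory.empiricalMomentumField ((Φ N).flow s z) (fun y => k (x - y))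 i * Literature.MathematicalPhysics.KineticTheory.empiricalMomentumField ((Φ N).flow s z) (fun y => k (x - y)) j / Literature.MathematicalPhysics.KineticTheory.empiricalDensityField ((Φ N).flow s z) (fun y => k (x - y))) * Literature.Analysis.FunctionSpaces.Torus.partialDeriv j (fun y => φ y i) x) + Literature.MathematicalPhysics.KineticTheory.hsPressure σ (Literature.MathematicalPhysics.KineticTheory.empiricalDensityField ((Φ N).flow s z) (fun y => k (x - y))) (2 / 3 * (Literature.MathematicalPhysics.KineticTheory.empiricalEnergyField ((Φ N).flow s z) (fun y => k (x - y)) / Literature.MathematicalPhysics.KineticTheory.empiricalDensityField ((Φ N).flow s z) (fun y => k (x - y)) - ‖Literature.MathematicalPhysics.KineticTheory.empiricalMomentumField ((Φ N).flow s z) (fun y => k (x - y))‖ ^ 2 / (2 * Literature.MathematicalPhysics.KineticTheory.empiricalDensityField ((Φ N).flow s z) (fun y => k (x - y)) ^ 2))) * Literature.Analysis.FunctionSpaces.Torus.divergence φ x))) → MeasureTheory.Integrable D (Literature.MathematicalPhysics.KineticTheory.localGibbsLaw σ a₀ u₀ θ₀ N (Φ N)) ∧ |∫ z, D z ∂Literature.MathematicalPhysics.KineticTheory.localGibbsLaw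 σ a₀ u₀ θ₀ N (Φ N)| ≤ ε)

/-- **GLUE CS (sorry-free): FLUX-RS + VIRIAL ⇒ CS**, through the LANDED contact-remainder mean bound
`Summit.AtomisticToContinuum.HydrodynamicLimit.Theorems.stub_collisionalStressTransferMeanBound` (worker CS, p149798):
pointwise `cW_φ + J − I = c(W_φ − collisionalStress(Dφ)) + (c·collisionalStress(Dφ) + J − I)`; the first summand has
`∫|·| ≤ M σ_N² c ∫RS = M σ_N · E[σ_N c RS] ≤ M σ_N C ≤ ε/2` eventually in N (FLUX-RS mean bound, `σ_N → 0`), the second is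
VIRIAL with ε/2; `σ₀ := min (min σ₁ σ₂) (1/2)`. -/
theorem fluxRS_virial_imply_collisionalStressClosure :
    RelSpeedCollisionMeanBound → CollisionalVirialClosure → CollisionalStressClosure := by
  unfold RelSpeedCollisionMeanBound CollisionalVirialClosure CollisionalStressClosure
  intro hF hV a₀ θ₀ u₀ ha hθ hu hap hθp
  obtain ⟨σ₁, hσ₁, H1⟩ := hF a₀ θ₀ u₀ ha hθ hu hap hθp
  obtain ⟨σ₂, hσ₂, H2⟩ := hV a₀ θ₀ u₀ ha hθ hu hap hθp
  refine ⟨min (min σ₁ σ₂) (1 / 2), lt_min (lt_min hσ₁ hσ₂) one_half_pos, ?_⟩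
  intro σ hσ hσlt Φ t₁ t₂ h₁ h₁₂ ε hε φ hφ
  have hσ1 : σ < σ₁ := lt_of_lt_of_le hσlt ((min_le_left _ _).trans (min_le_left _ _))
  have hσ2 : σ < σ₂ := lt_of_lt_of_le hσlt ((min_le_left _ _).trans (min_le_right _ _))
  have hσh : σ < 1 / 2 := lt_of_lt_of_le hσlt (min_le_right _ _)
  obtain ⟨C', hC'⟩ := H1 σ hσ hσ1 Φ t₁ t₂ h₁ h₁₂
  obtain ⟨ℓ, hℓ, K2⟩ := H2 σ hσ hσ2 Φ t₁ t₂ h₁ h₁₂ (ε / 2) (half_pos hε) φ hφ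
  refine ⟨ℓ, hℓ, fun k hk => ?_⟩
  obtain ⟨L, M, -, hM, HR⟩ :=
    Summit.AtomisticToContinuum.HydrodynamicLimit.Theorems.stub_collisionalStressTransferMeanBound φ hφ
  -- the remainder's mean bound `M σ_N max C' 0` is eventually below `ε / 2`
  have hsmall : ∀ᶠ N in atTop, M * hsDiameter σ N * max C' 0 ≤ ε / 2 := by
    have ht : Tendsto (fun N => M * hsDiameter σ N * max C' 0) atTop (𝓝 (M * 0 * max C' 0)) :=
      ((tendsto_hsDiameter σ).const_mul M).mul_const (max C' 0)
    rw [mul_zero, zero_mul] at ht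
    exact ht.eventually (Iic_mem_nhds (half_pos hε))
  filter_upwards [hC', K2 k hk, hsmall] with N hNF hNV hNs
  intro D hD
  set μ := localGibbsLaw σ a₀ u₀ θ₀ N (Φ N) with hμdef
  set c : ℝ := ((N + 1 : ℕ) : ℝ)⁻¹ with hcdef
  set εN : ℝ := hsDiameter σ N with hεNdef
  have hεN : 0 < εN := hsDiameter_pos hσ N
  have hc : 0 < c := inv_pos.2 (Nat.cast_pos.2 (Nat.succ_pos N))
  set RS : Config (N + 1) (Fin 3) T3 → ℝ := fun z => (Φ N).collisionalTransferFunctional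
    (fun (i j : Fin (N + 1)) (pre _post : Config (N + 1) (Fin 3) T3) => ‖(pre i).2 - (pre j).2‖)
    ((Φ N).flow t₁ z) (t₂ - t₁) with hRSdef
  obtain ⟨hQi, hQm⟩ := hNF (fun z => εN * c * RS z) rfl
  have hRSi : Integrable RS μ := by
    have h := hQi.const_mul (εN * c)⁻¹
    refine h.congr (Eventually.of_forall fun z => ?_)
    show (εN * c)⁻¹ * (εN * c * RS z) = RS z
    rw [← mul_assoc, inv_mul_cancel₀ (mul_pos hεN hc).ne', one_mul]
  obtain ⟨-, hremi, hremb⟩ := HR σ hσ.le hσh a₀ θ₀ u₀ N (Φ N) t₁ t₂ h₁ h₁₂ hRSi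
  have hrem : ∫ z, |c * ((Φ N).momentumTransfer φ ((Φ N).flow t₁ z) (t₂ - t₁) -
      (Φ N).collisionalStress (Torus.fderiv φ) ((Φ N).flow t₁ z) (t₂ - t₁))| ∂μ ≤ ε / 2 := by
    have hQint : ∫ z, εN * c * RS z ∂μ = εN * c * ∫ z, RS z ∂μ := integral_const_mul _ _
    calc ∫ z, |c * ((Φ N).momentumTransfer φ ((Φ N).flow t₁ z) (t₂ - t₁) -
          (Φ N).collisionalStress (Torus.fderiv φ) ((Φ N).flow t₁ z) (t₂ - t₁))| ∂μ
        ≤ M * εN ^ 2 * c * ∫ z, RS z ∂μ := hremb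
      _ = M * εN * ∫ z, εN * c * RS z ∂μ := by rw [hQint]; ring
      _ ≤ M * εN * max C' 0 :=
          mul_le_mul_of_nonneg_left (hQm.trans (le_max_left _ _)) (mul_nonneg hM hεN.le)
      _ ≤ ε / 2 := hNs
  subst hD
  refine integrable_and_abs_integral_le_of_ae_eq_add (Eventually.of_forall fun z => ?_)
    ⟨hremi, (abs_integral_le_integral_abs).trans hrem⟩ (hNV _ rfl)
  ring

/-- Stub CS, now a THEOREM of the skeleton from stubs FLUX-RS and VIRIAL (and the landed contact remainder). -/
theorem stub_collisionalStressClosure : ∀ (a₀ θ₀ : Literature.MathematicalPhysics.KineticTheory.T3 → ℝ) (u₀ : Literature.MathematicalPhysics.KineticTheory.T3 → Literature.MathematicalPhysics.KineticTheory.V3), Continuous a₀ → Continuous θ₀ → Continuous u₀ → (∀ x, 0 < a₀ x) → (∀ x, 0 < θ₀ x) → ∃ σ₀ : ℝ, 0 < σ₀ ∧ ∀ σ : ℝ, 0 < σ → σ < σ₀ → ∀ Φ : (N : ℕ) → Literature.Analysis.FluidPDE.HardSphereFlow (Literature.Analysis.FluidPDE.Torus.geometry (Fin 3)) (Literature.MathematicalPhysics.KineticTheory.hsDiameter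 σ N) (N + 1), ∀ t₁ t₂ : ℝ, 0 ≤ t₁ → t₁ ≤ t₂ → ∀ ε : ℝ, 0 < ε → (∀ φ : Literature.MathematicalPhysics.KineticTheory.T3 → Literature.MathematicalPhysics.KineticTheory.V3, Literature.Analysis.FunctionSpaces.Torus.IsSmooth φ → ∃ ℓ : ℝ, 0 < ℓ ∧ ∀ k : Literature.MathematicalPhysics.KineticTheory.T3 → ℝ, (Continuous k ∧ (∀ y, 0 ≤ k y) ∧ (∫ y, k y = 1) ∧ (∀ y, k y ≠ 0 → Literature.Analysis.FluidPDE.Torus.euclidDist y 0 < ℓ)) → ∀ᶠ N in Filter.atTop, ∀ D : Literature.Analysis.FluidPDE.Config (N + 1) (Fin 3) Literature.MathematicalPhysics.KineticTheory.T3 → ℝ, D = (fun z => ((N + 1 : ℕ) : ℝ)⁻¹ * (Φ N).momentumTransfer φ ((Φ N).flow t₁ z) (t₂ - t₁) + (∫ s in t₁..t₂, ∫ x, ((∑ i, ∑ j, (Literature.MathematicalPhysics.KineticTheory.empiricalMomentumField ((Φ N).flow s z) (fun y => k (x - y)) i * Literature.MathematicalPhysics.KineticTheory.empiricalMomentumField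 ((Φ N).flow s z) (fun y => k (x - y)) j / Literature.MathematicalPhysics.KineticTheory.empiricalDensityField ((Φ N).flow s z) (fun y => k (x - y))) * Literature.Analysis.FunctionSpaces.Torus.partialDeriv j (fun y => φ y i) x) + Literature.MathematicalPhysics.KineticTheory.empiricalDensityField ((Φ N).flow s z) (fun y => k (x - y)) * (2 / 3 * (Literature.MathematicalPhysics.KineticTheory.empiricalEnergyField ((Φ N).flow s z) (fun y => k (x - y)) / Literature.MathematicalPhysics.KineticTheory.empiricalDensityField ((Φ N).flow s z) (fun y => k (x - y)) - ‖Literature.MathematicalPhysics.KineticTheory.empiricalMomentumField ((Φ N).flow s z) (fun y => k (x - y))‖ ^ 2 / (2 * Literature.MathematicalPhysics.KineticTheory.empiricalDensityField ((Φ N).flow s z) (fun y => k (x - y)) ^ 2))) * Literature.Analysis.FunctionSpaces.Torus.divergence φ x)) - (∫ s in t₁..t₂, ∫ x, ((∑ i, ∑ j, (Literature.MathematicalPhysics.KineticTheory.empiricalMomentumField ((Φ N).flow s z) (fun y => k (x - y)) i * Literature.MathematicalPhysics.KineticTheory.empiricalMomentumField ((Φ N).flow s z) (fun y => k (x - y))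 j / Literature.MathematicalPhysics.KineticTheory.empiricalDensityField ((Φ N).flow s z) (fun y => k (x - y))) * Literature.Analysis.FunctionSpaces.Torus.partialDeriv j (fun y => φ y i) x) + Literature.MathematicalPhysics.KineticTheory.hsPressure σ (Literature.MathematicalPhysics.KineticTheory.empiricalDensityField ((Φ N).flow s z) (fun y => k (x - y))) (2 / 3 * (Literature.MathematicalPhysics.KineticTheory.empiricalEnergyField ((Φ N).flow s z) (fun y => k (x - y)) / Literature.MathematicalPhysics.KineticTheory.empiricalDensityField ((Φ N).flow s z) (fun y => k (x - y)) - ‖Literature.MathematicalPhysics.KineticTheory.empiricalMomentumField ((Φ N).flow s z) (fun y => k (x - y))‖ ^ 2 / (2 * Literature.MathematicalPhysics.KineticTheory.empiricalDensityField ((Φ N).flow s z) (fun y => k (x - y)) ^ 2))) * Literature.Analysis.FunctionSpaces.Torus.divergence φ x))) → MeasureTheory.Integrable D (Literature.MathematicalPhysics.KineticTheory.localGibbsLaw σ a₀ u₀ θ₀ N (Φ N)) ∧ |∫ z, D z ∂Literature.MathematicalPhysics.KineticTheory.localGibbsLaw σ a₀ u₀ θ₀ N (Φ N)| ≤ ε)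 := by
  have h := fluxRS_virial_imply_collisionalStressClosure
  unfold RelSpeedCollisionMeanBound CollisionalVirialClosure CollisionalStressClosure at h
  exact h stub_relSpeedCollisionMeanBound stub_collisionalVirialClosure


/-- Signature of the planner's stub M (mean momentum-flux closure; second conjunct of the crux under
the common prefix) as a named proposition (verbatim). -/
def MomentumFluxClosure : Prop := ∀ (a₀ θ₀ : Literature.MathematicalPhysics.KineticTheory.T3 → ℝ) (u₀ : Literature.MathematicalPhysics.KineticTheory.T3 → Literature.MathematicalPhysics.KineticTheory.V3), Continuous a₀ → Continuous θ₀ → Continuous u₀ → (∀ x, 0 < a₀ x) → (∀ x, 0 < θ₀ x) → ∃ σ₀ : ℝ, 0 < σ₀ ∧ ∀ σ : ℝ, 0 < σ → σ < σ₀ → ∀ Φ : (N : ℕ) → Literature.Analysis.FluidPDE.HardSphereFlow (Literature.Analysis.FluidPDE.Torus.geometry (Fin 3)) (Literature.MathematicalPhysics.KineticTheory.hsDiameter σ N) (N + 1), ∀ t₁ t₂ : ℝ, 0 ≤ t₁ → t₁ ≤ t₂ → ∀ ε : ℝ, 0 < ε → (∀ φ : Literature.MathematicalPhysics.KineticTheory.T3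 → Literature.MathematicalPhysics.KineticTheory.V3, Literature.Analysis.FunctionSpaces.Torus.IsSmooth φ → ∃ ℓ : ℝ, 0 < ℓ ∧ ∀ k : Literature.MathematicalPhysics.KineticTheory.T3 → ℝ, (Continuous k ∧ (∀ y, 0 ≤ k y) ∧ (∫ y, k y = 1) ∧ (∀ y, k y ≠ 0 → Literature.Analysis.FluidPDE.Torus.euclidDist y 0 < ℓ)) → ∀ᶠ N in Filter.atTop, let D : Literature.Analysis.FluidPDE.Config (N + 1) (Fin 3) Literature.MathematicalPhysics.KineticTheory.T3 → ℝ := fun z => ((∑ i, (Literature.MathematicalPhysics.KineticTheory.empiricalMomentumField ((Φ N).flow t₂ z) (fun y => φ y i)) i) - (∑ i, (Literature.MathematicalPhysics.KineticTheory.empiricalMomentumField ((Φ N).flow t₁ z) (fun y => φ y i)) i)) - ∫ s in t₁..t₂, ∫ x, (let R : ℝ := Literature.MathematicalPhysics.KineticTheory.empiricalDensityField ((Φ N).flow s z) (fun y => k (x - y)); let Mv : Literature.MathematicalPhysics.KineticTheory.V3 := Literature.MathematicalPhysics.KineticTheory.empiricalMomentumField ((Φ N).flow s z) (fun y => k (x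 - y)); let En : ℝ := Literature.MathematicalPhysics.KineticTheory.empiricalEnergyField ((Φ N).flow s z) (fun y => k (x - y)); let Θ : ℝ := 2 / 3 * (En / R - ‖Mv‖ ^ 2 / (2 * R ^ 2)); let Pr : ℝ := Literature.MathematicalPhysics.KineticTheory.hsPressure σ R Θ; (∑ i, ∑ j, (Mv i * Mv j / R) * Literature.Analysis.FunctionSpaces.Torus.partialDeriv j (fun y => φ y i) x) + Pr * Literature.Analysis.FunctionSpaces.Torus.divergence φ x); MeasureTheory.Integrable D (Literature.MathematicalPhysics.KineticTheory.localGibbsLaw σ a₀ u₀ θ₀ N (Φ N)) ∧ |∫ z, D z ∂Literature.MathematicalPhysics.KineticTheory.localGibbsLaw σ a₀ u₀ θ₀ N (Φ N)| ≤ ε)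

/-- Signature of stub KE-a1 as a named proposition (verbatim). -/
def EnergyCommutatorBoundary : Prop := ∀ (a₀ θ₀ : Literature.MathematicalPhysics.KineticTheory.T3 → ℝ) (u₀ : Literature.MathematicalPhysics.KineticTheory.T3 → Literature.MathematicalPhysics.KineticTheory.V3), Continuous a₀ → Continuous θ₀ → Continuous u₀ → (∀ x, 0 < a₀ x) → (∀ x, 0 < θ₀ x) → ∃ σ₀ : ℝ, 0 < σ₀ ∧ ∀ σ : ℝ, 0 < σ → σ < σ₀ → ∀ Φ : (N : ℕ) → Literature.Analysis.FluidPDE.HardSphereFlow (Literature.Analysis.FluidPDE.Torus.geometry (Fin 3)) (Literature.MathematicalPhysics.KineticTheory.hsDiameter σ N) (N + 1), ∀ t₁ t₂ : ℝ, 0 ≤ t₁ → t₁ ≤ t₂ → ∀ ε : ℝ, 0 < ε → (∀ ψ : Literature.MathematicalPhysics.KineticTheory.T3 → ℝ, Literature.Analysis.FunctionSpaces.Torus.IsSmooth ψ → ∃ ℓ : ℝ, 0 < ℓ ∧ ∀ k : Literature.MathematicalPhysics.KineticTheory.T3 → ℝ, (Continuous k ∧ (∀ y, 0 ≤ k y)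 ∧ (∫ y, k y = 1) ∧ (∀ y, k y ≠ 0 → Literature.Analysis.FluidPDE.Torus.euclidDist y 0 < ℓ)) → ∀ᶠ N in Filter.atTop, ∀ D : Literature.Analysis.FluidPDE.Config (N + 1) (Fin 3) Literature.MathematicalPhysics.KineticTheory.T3 → ℝ, D = (fun z => ((N + 1 : ℕ) : ℝ)⁻¹ * (∫ s in t₁..t₂, Literature.Analysis.FluidPDE.energyStreaming ψ ((Φ N).flow s z)) - (∫ s in t₁..t₂, ∫ x, ((N + 1 : ℕ) : ℝ)⁻¹ * ∑ a, k (x - ((Φ N).flow s z a).1) * ((∑ i, ((Φ N).flow s z a).2 i * Literature.Analysis.FunctionSpaces.Torus.partialDeriv i ψ x) * (‖((Φ N).flow s z a).2‖ ^ 2 / 2))) + ((N + 1 : ℕ) : ℝ)⁻¹ * (Φ N).energyTransfer (fun y => ψ y - ∫ x, k (x - y) * ψ x) ((Φ N).flow t₁ z) (t₂ - t₁)) → MeasureTheory.Integrable D (Literature.MathematicalPhysics.KineticTheory.localGibbsLaw σ a₀ u₀ θ₀ N (Φ N)) ∧ |∫ z, D z ∂Literature.MathematicalPhysics.KineticTheory.localGibbsLaw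 σ a₀ u₀ θ₀ N (Φ N)| ≤ ε)

/-- Signature of stub FLUX as a named proposition (verbatim). -/
def CollisionEnergyExchangeMeanBound : Prop := ∀ (a₀ θ₀ : Literature.MathematicalPhysics.KineticTheory.T3 → ℝ) (u₀ : Literature.MathematicalPhysics.KineticTheory.T3 → Literature.MathematicalPhysics.KineticTheory.V3), Continuous a₀ → Continuous θ₀ → Continuous u₀ → (∀ x, 0 < a₀ x) → (∀ x, 0 < θ₀ x) → ∃ σ₀ : ℝ, 0 < σ₀ ∧ ∀ σ : ℝ, 0 < σ → σ < σ₀ → ∀ Φ : (N : ℕ) → Literature.Analysis.FluidPDE.HardSphereFlow (Literature.Analysis.FluidPDE.Torus.geometry (Fin 3)) (Literature.MathematicalPhysics.KineticTheory.hsDiameter σ N) (N + 1), ∀ t₁ t₂ : ℝ, 0 ≤ t₁ → t₁ ≤ t₂ → ∃ C : ℝ, ∀ᶠ N in Filter.atTop, ∀ Q : Literature.Analysis.FluidPDE.Config (N + 1) (Fin 3) Literature.MathematicalPhysics.KineticTheory.T3 → ℝ, Q = (fun z => Literature.MathematicalPhysics.KineticTheory.hsDiameter σ N * ((N + 1 :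 ℕ) : ℝ)⁻¹ * (Φ N).collisionalTransferFunctional (fun (i _j : Fin (N + 1)) (pre post : Literature.Analysis.FluidPDE.Config (N + 1) (Fin 3) Literature.MathematicalPhysics.KineticTheory.T3) => |‖(post i).2‖ ^ 2 - ‖(pre i).2‖ ^ 2| / 2) ((Φ N).flow t₁ z) (t₂ - t₁)) → MeasureTheory.Integrable Q (Literature.MathematicalPhysics.KineticTheory.localGibbsLaw σ a₀ u₀ θ₀ N (Φ N)) ∧ ∫ z, Q z ∂Literature.MathematicalPhysics.KineticTheory.localGibbsLaw σ a₀ u₀ θ₀ N (Φ N) ≤ C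

/-- Collision part of the streaming energy commutator (KE-a2 = −cW^e_χ; verbatim signature), derived
below from stub FLUX. -/
def EnergyCommutatorCollisions : Prop := ∀ (a₀ θ₀ : Literature.MathematicalPhysics.KineticTheory.T3 → ℝ) (u₀ : Literature.MathematicalPhysics.KineticTheory.T3 → Literature.MathematicalPhysics.KineticTheory.V3), Continuous a₀ → Continuous θ₀ → Continuous u₀ → (∀ x, 0 < a₀ x) → (∀ x, 0 < θ₀ x) → ∃ σ₀ : ℝ, 0 < σ₀ ∧ ∀ σ : ℝ, 0 < σ → σ < σ₀ → ∀ Φ : (N : ℕ) → Literature.Analysis.FluidPDE.HardSphereFlow (Literature.Analysis.FluidPDE.Torus.geometry (Fin 3)) (Literature.MathematicalPhysics.KineticTheory.hsDiameter σ N) (N + 1), ∀ t₁ t₂ : ℝ, 0 ≤ t₁ → t₁ ≤ t₂ → ∀ ε : ℝ, 0 < ε → (∀ ψ : Literature.MathematicalPhysics.KineticTheory.T3 → ℝ, Literature.Analysis.FunctionSpaces.Torus.IsSmooth ψ → ∃ ℓ : ℝ, 0 < ℓ ∧ ∀ k : Literature.MathematicalPhysics.KineticTheory.T3 → ℝ,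 (Continuous k ∧ (∀ y, 0 ≤ k y) ∧ (∫ y, k y = 1) ∧ (∀ y, k y ≠ 0 → Literature.Analysis.FluidPDE.Torus.euclidDist y 0 < ℓ)) → ∀ᶠ N in Filter.atTop, ∀ D : Literature.Analysis.FluidPDE.Config (N + 1) (Fin 3) Literature.MathematicalPhysics.KineticTheory.T3 → ℝ, D = (fun z => -(((N + 1 : ℕ) : ℝ)⁻¹ * (Φ N).energyTransfer (fun y => ψ y - ∫ x, k (x - y) * ψ x) ((Φ N).flow t₁ z) (t₂ - t₁))) → MeasureTheory.Integrable D (Literature.MathematicalPhysics.KineticTheory.localGibbsLaw σ a₀ u₀ θ₀ N (Φ N)) ∧ |∫ z, D z ∂Literature.MathematicalPhysics.KineticTheory.localGibbsLaw σ a₀ u₀ θ₀ N (Φ N)| ≤ ε)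

/-! ## Glue KE-a2 ⟸ FLUX (lead, r4) -/

section KEa2Glue

variable {k : T3 → ℝ} {ℓ : ℝ} {ψ : T3 → ℝ} {n : ℕ}

/-- The reflected kernel is integrable. -/
theorem kea2_integrable_reflect (hk : Continuous k) : Integrable (fun y : T3 => k (-y)) :=
  integrable_of_continuous_T3 (hk.comp continuous_neg)

/-- `(ǩ ⋆ g)(y) = ∫ k(x − y) g(x) dx`. -/
theorem kea2_reflect_convolution_apply (k : T3 → ℝ) (g : T3 → ℝ) (y : T3) :
    ((fun t : T3 => k (-t)) ⋆ g) y = ∫ x, k (x - y) * g x := by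
  rw [convolution_lsmul]
  simp only [smul_eq_mul]
  haveI := MesoLLN.isNegInvariant_volume_T3
  have h1 : ∫ t : T3, k (-t) * g (y - t) = ∫ t : T3, k t * g (y + t) := by
    rw [← integral_neg_eq_self (fun t : T3 => k t * g (y + t)) volume]
    simp [sub_eq_add_neg]
  rw [h1, ← integral_add_right_eq_self (fun x : T3 => k (x - y) * g x) y]
  refine integral_congr_ae (Eventually.of_forall fun t => ?_)
  simp [add_comm]

/-- The defect `χ = ψ − ǩ ⋆ ψ` as the function of the stub. -/
theorem kea2_defect_eq (k : T3 → ℝ) (ψ : T3 → ℝ) :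
    (fun y => ψ y - ∫ x, k (x - y) * ψ x) = ψ - ((fun t : T3 => k (-t)) ⋆ ψ) := by
  funext y
  rw [Pi.sub_apply, kea2_reflect_convolution_apply]

/-- The defect is smooth. -/
theorem kea2_isSmooth_defect (hk : Continuous k) (hψ : Torus.IsSmooth ψ) :
    Torus.IsSmooth (fun y => ψ y - ∫ x, k (x - y) * ψ x) := by
  rw [kea2_defect_eq]
  exact hψ.sub (Torus.isSmooth_convolution (kea2_integrable_reflect hk) hψ)

/-- Sup bound on a mollification defect: `|g(y) − ∫ k(x−y) g(x) dx| ≤ ℓ L` for smooth `g` with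
`‖∇g‖ ≤ L` and a probability kernel `k ≥ 0` supported in the `ℓ`-ball. -/
theorem kea2_abs_defect_le (hk : Continuous k) (hk0 : ∀ y, 0 ≤ k y) (hk1 : ∫ y, k y = 1)
    (hsupp : ∀ y, k y ≠ 0 → Torus.euclidDist y 0 < ℓ) {g : T3 → ℝ} (hg : Torus.IsSmooth g) {L : ℝ}
    (hL : ∀ x, ‖Torus.gradient g x‖ ≤ L) (y : T3) :
    |g y - ∫ x, k (x - y) * g x| ≤ ℓ * L := by
  have hsupp' : ∀ y, ℓ ≤ Torus.euclidDist y 0 → k (-y) = 0 := by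
    intro y hy
    by_contra h
    have h1 := hsupp (-y) h
    rw [show (-y : T3) = 0 - y from (zero_sub y).symm, MesoLLN.euclidDist_sub_zero,
      Torus.euclidDist_comm] at h1
    rw [show Torus.euclidDist y 0 = Torus.euclidDist (y - 0) 0 by rw [sub_zero],
      MesoLLN.euclidDist_sub_zero] at hy
    exact absurd h1 (not_lt.2 hy)
  have hint1 : ∫ y : T3, k (-y) = 1 := by
    haveI := MesoLLN.isNegInvariant_volume_T3
    rw [integral_neg_eq_self k volume, hk1]
  have h := B4.abs_sub_integral_mul_translate_le (φ := fun t : T3 => k (-t)) (r := ℓ) (L := L)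
    (fun t => hk0 _) (kea2_integrable_reflect hk) hint1 hsupp' hg hL y
  have hre : ∫ x, g x * (fun t : T3 => k (-t)) (y - x) = ∫ x, k (x - y) * g x :=
    integral_congr_ae (Eventually.of_forall fun x => by simp [neg_sub, mul_comm])
  rwa [hre] at h

/-- `D(f − g) = Df − Dg` on the torus. -/
theorem kea2_torusFderiv_sub {f g : T3 → ℝ} (hf : Torus.IsContDiff 1 f) (hg : Torus.IsContDiff 1 g)
    (x : T3) : Torus.fderiv (f - g) x = Torus.fderiv f x - Torus.fderiv g x := by
  unfold Torus.fderiv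
  rw [show Torus.liftAt (f - g) x = Torus.liftAt f x - Torus.liftAt g x from rfl]
  exact _root_.fderiv_sub ((hf.liftAt x).differentiable one_ne_zero).differentiableAt
    ((hg.liftAt x).differentiable one_ne_zero).differentiableAt

/-- Partial derivatives of the defect are defects of the partial derivatives:
`∂ᵢχ(y) = ∂ᵢψ(y) − ∫ k(x − y) ∂ᵢψ(x) dx`. -/
theorem kea2_partialDeriv_defect (hk : Continuous k) (hψ : Torus.IsSmooth ψ) (i : Fin 3) (y : T3) :
    Torus.partialDeriv i (fun y => ψ y - ∫ x, k (x - y) * ψ x) y =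
      Torus.partialDeriv i ψ y - ∫ x, k (x - y) * Torus.partialDeriv i ψ x := by
  have hψ1 : Torus.IsContDiff 1 ψ := hψ.isContDiff (by simp)
  have hm : Torus.IsSmooth ((fun t : T3 => k (-t)) ⋆ ψ) :=
    Torus.isSmooth_convolution (kea2_integrable_reflect hk) hψ
  have hm1 : Torus.IsContDiff 1 ((fun t : T3 => k (-t)) ⋆ ψ) := hm.isContDiff (by simp)
  have hχ1 : Torus.IsContDiff 1 (fun y => ψ y - ∫ x, k (x - y) * ψ x) :=
    (kea2_isSmooth_defect hk hψ).isContDiff (by simp)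
  rw [Torus.partialDeriv_eq_fderiv_apply hχ1, kea2_defect_eq, kea2_torusFderiv_sub hψ1 hm1,
    sub_apply, ← Torus.partialDeriv_eq_fderiv_apply hψ1,
    ← Torus.partialDeriv_eq_fderiv_apply hm1,
    Torus.partialDeriv_convolution (kea2_integrable_reflect hk) hψ, kea2_reflect_convolution_apply]

/-- **Derivative bound on the defect**: `‖Dχ(y)‖ ≤ ℓ Σᵢ Lᵢ` when `‖∇∂ᵢψ‖ ≤ Lᵢ`. -/
theorem kea2_norm_fderiv_defect_le (hk : Continuous k) (hk0 : ∀ y, 0 ≤ k y) (hk1 : ∫ y, k y = 1)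
    (hsupp : ∀ y, k y ≠ 0 → Torus.euclidDist y 0 < ℓ) (hψ : Torus.IsSmooth ψ) {L : Fin 3 → ℝ}
    (hL : ∀ i x, ‖Torus.gradient (Torus.partialDeriv i ψ) x‖ ≤ L i) (hℓ : 0 ≤ ℓ) (y : T3) :
    ‖Torus.fderiv (fun y => ψ y - ∫ x, k (x - y) * ψ x) y‖ ≤ ℓ * ∑ i, L i := by
  have hχ1 : Torus.IsContDiff 1 (fun y => ψ y - ∫ x, k (x - y) * ψ x) :=
    (kea2_isSmooth_defect hk hψ).isContDiff (by simp)
  have hLi : ∀ i, 0 ≤ L i := fun i => (norm_nonneg _).trans (hL i y)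
  have hpart : ∀ i, |Torus.partialDeriv i (fun y => ψ y - ∫ x, k (x - y) * ψ x) y| ≤ ℓ * L i := by
    intro i
    rw [kea2_partialDeriv_defect hk hψ]
    exact kea2_abs_defect_le hk hk0 hk1 hsupp (hψ.partialDeriv i) (hL i) y
  refine ContinuousLinearMap.opNorm_le_bound _ (mul_nonneg hℓ (Finset.sum_nonneg fun i _ => hLi i)) fun w => ?_
  rw [Torus.fderiv_apply_eq_sum_partialDeriv hχ1]
  calc ‖∑ i, w i • Torus.partialDeriv i (fun y => ψ y - ∫ x, k (x - y) * ψ x) y‖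
      ≤ ∑ i, ‖w i • Torus.partialDeriv i (fun y => ψ y - ∫ x, k (x - y) * ψ x) y‖ := norm_sum_le _ _
    _ ≤ ∑ i, ‖w‖ * (ℓ * L i) := Finset.sum_le_sum fun i _ => by
        rw [norm_smul, Real.norm_eq_abs, Real.norm_eq_abs]
        exact mul_le_mul (by simpa using PiLp.norm_apply_le w i) (hpart i)
          (abs_nonneg _) (norm_nonneg _)
    _ = ℓ * (∑ i, L i) * ‖w‖ := by rw [← Finset.mul_sum, ← Finset.mul_sum]; ring

/-- **Pathwise bound**: on the good set the collisional energy transfer of the defect over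
`(t₁, t₂]` is at most `Lχ · σ_N · ½ 𝒮ᴱ(t₁, t₂]` (`𝒮ᴱ` the absolute energy-jump functional). -/
theorem kea2_abs_energyTransfer_flow_le {ε : ℝ} (Φ : HardSphereFlow (Torus.geometry (Fin 3)) ε n)
    {χ : T3 → ℝ} (hχ : Torus.IsContDiff 1 χ) {Lχ : ℝ} (hLχ : ∀ x, ‖Torus.fderiv χ x‖ ≤ Lχ)
    {z : Config n (Fin 3) T3} (hz : z ∈ Φ.good) (t₁ h : ℝ) :
    |Φ.energyTransfer χ (Φ.flow t₁ z) h| ≤ Lχ * ε * (2⁻¹ * Φ.collisionalTransferFunctional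
      (fun (i _j : Fin n) (pre post : Config n (Fin 3) T3) => |‖(post i).2‖ ^ 2 - ‖(pre i).2‖ ^ 2| / 2)
      (Φ.flow t₁ z) h) := by
  have htraj := Φ.isTrajectory (Φ.flow t₁ z) (Φ.mapsTo_good t₁ hz)
  have hL : ∀ x y, ‖χ x - χ y‖ ≤ Lχ * ‖(Torus.geometry (Fin 3)).sepVec x y‖ :=
    norm_sub_le_of_fderiv_le hχ hLχ
  exact abs_energyTransfer_le htraj hL 0 h

/-- The collisional energy transfer of the time-`t₁` point over `(0, t₂ − t₁]` is a.e.-measurable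
under any law absolutely continuous w.r.t. Liouville (cocycle + `CollisionalTransferMeasurable`). -/
theorem kea2_aemeasurable_energyTransfer_flow {ε : ℝ} (Φ : HardSphereFlow (Torus.geometry (Fin 3)) ε n)
    {χ : T3 → ℝ} (hχ : Torus.IsContDiff 1 χ) {t₁ t₂ : ℝ} (h₁ : 0 ≤ t₁) (h₁₂ : t₁ ≤ t₂)
    {μ : Measure (Config n (Fin 3) T3)} (hμ : μ ≪ liouville (Torus.geometry (Fin 3)) n ε) :
    AEMeasurable (fun z => Φ.energyTransfer χ (Φ.flow t₁ z) (t₂ - t₁)) μ := by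
  have hcocycle : (fun z => Φ.energyTransfer χ (Φ.flow t₁ z) (t₂ - t₁)) =ᵐ[μ]
      fun z => Φ.energyTransfer χ z t₂ - Φ.energyTransfer χ z t₁ := by
    filter_upwards [hμ.ae_le Φ.ae_mem_good] with z hz
    have := Φ.energyTransfer_add_torus χ hz h₁ (sub_nonneg.2 h₁₂)
    rw [add_sub_cancel] at this
    linarith
  exact (((Φ.aemeasurable_energyTransfer_torus_of_absolutelyContinuous hχ t₂ hμ).sub
    (Φ.aemeasurable_energyTransfer_torus_of_absolutelyContinuous hχ t₁ hμ)).congr hcocycle.symm)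

/-- **GLUE KE-a2 (sorry-free): a mean collisional energy-exchange bound implies the collision part
of the streaming energy commutator.** `|cW^e_χ| ≤ ℓ (Σᵢ sup‖∇∂ᵢψ‖) · (σ_N c ½𝒮ᴱ)` pathwise on the
good set; integrability by domination, `|E| ≤ ℓ (Σᵢ Lᵢ) C / 2 ≤ ε` for `ℓ` small. -/
theorem flux_imply_energyCommutatorCollisions :
    CollisionEnergyExchangeMeanBound → EnergyCommutatorCollisions := by
  unfold CollisionEnergyExchangeMeanBound EnergyCommutatorCollisions
  intro hF a₀ θ₀ u₀ ha hθ hu hap hθp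
  obtain ⟨σ₀, hσ₀, H⟩ := hF a₀ θ₀ u₀ ha hθ hu hap hθp
  refine ⟨σ₀, hσ₀, ?_⟩
  intro σ hσ hσlt Φ t₁ t₂ h₁ h₁₂ ε hε ψ hψ
  obtain ⟨C, hC⟩ := H σ hσ hσlt Φ t₁ t₂ h₁ h₁₂
  -- second-derivative bounds of ψ
  have hLi : ∀ i : Fin 3, ∃ L, ∀ x, ‖Torus.gradient (Torus.partialDeriv i ψ) x‖ ≤ L := by
    intro i
    have h1 : Torus.IsContDiff 1 (Torus.partialDeriv i ψ) := (hψ.partialDeriv i).isContDiff (by simp)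
    obtain ⟨L, -, hL⟩ := exists_fderiv_le h1
    exact ⟨L, fun x => by rw [B4.norm_gradient_eq_norm_fderiv]; exact hL x⟩
  choose L hL using hLi
  have hL0 : ∀ i, 0 ≤ L i := fun i => (norm_nonneg _).trans (hL i 0)
  set L' : ℝ := ∑ i, L i with hL'def
  have hL'0 : 0 ≤ L' := Finset.sum_nonneg fun i _ => hL0 i
  set C' : ℝ := max C 0 with hC'def
  have hC'0 : 0 ≤ C' := le_max_right _ _
  refine ⟨ε / (L' * C' + 1), div_pos hε (by positivity), ?_⟩
  intro k hk
  obtain ⟨hkc, hk0, hk1, hksupp⟩ := hk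
  filter_upwards [hC] with N hN
  intro D hD
  set ℓ : ℝ := ε / (L' * C' + 1) with hℓdef
  have hℓ0 : 0 ≤ ℓ := (div_pos hε (by positivity)).le
  set c : ℝ := ((N + 1 : ℕ) : ℝ)⁻¹ with hcdef
  have hc0 : 0 ≤ c := inv_nonneg.2 (Nat.cast_nonneg _)
  set χ : T3 → ℝ := fun y => ψ y - ∫ x, k (x - y) * ψ x with hχdef
  have hχ1 : Torus.IsContDiff 1 χ := (kea2_isSmooth_defect hkc hψ).isContDiff (by simp)
  have hDχ : ∀ y, ‖Torus.fderiv χ y‖ ≤ ℓ * L' :=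
    kea2_norm_fderiv_defect_le hkc hk0 hk1 hksupp hψ hL hℓ0
  set μ := localGibbsLaw σ a₀ u₀ θ₀ N (Φ N) with hμdef
  have hPac : μ ≪ liouville (Torus.geometry (Fin 3)) (N + 1) (hsDiameter σ N) := by
    rw [hμdef, localGibbsLaw_eq]
    exact localGibbsMeasure_absolutelyContinuous σ a₀ u₀ θ₀ N (Φ N)
  -- the flux functional
  set Q : Config (N + 1) (Fin 3) T3 → ℝ := fun z => hsDiameter σ N * c *
    (Φ N).collisionalTransferFunctional
      (fun (i _j : Fin (N + 1)) (pre post : Config (N + 1) (Fin 3) T3) => |‖(post i).2‖ ^ 2 - ‖(pre i).2‖ ^ 2| / 2)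
      ((Φ N).flow t₁ z) (t₂ - t₁) with hQdef
  obtain ⟨hQi, hQmean⟩ := hN Q rfl
  -- pathwise domination on the good set
  have hdom : ∀ᵐ z ∂μ, ‖D z‖ ≤ (ℓ * L' / 2) * Q z := by
    filter_upwards [hPac.ae_le (Φ N).ae_mem_good] with z hz
    have hb := kea2_abs_energyTransfer_flow_le (Φ N) hχ1 hDχ hz t₁ (t₂ - t₁)
    rw [hD, Real.norm_eq_abs, abs_neg, abs_mul, abs_of_nonneg hc0]
    calc c * |(Φ N).energyTransfer χ ((Φ N).flow t₁ z) (t₂ - t₁)|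
        ≤ c * (ℓ * L' * hsDiameter σ N * (2⁻¹ * (Φ N).collisionalTransferFunctional
            (fun (i _j : Fin (N + 1)) (pre post : Config (N + 1) (Fin 3) T3) =>
              |‖(post i).2‖ ^ 2 - ‖(pre i).2‖ ^ 2| / 2) ((Φ N).flow t₁ z) (t₂ - t₁))) :=
          mul_le_mul_of_nonneg_left hb hc0
      _ = ℓ * L' / 2 * Q z := by simp only [hQdef]; ring
  have hDm : AEStronglyMeasurable D μ := by
    rw [hD]
    exact ((kea2_aemeasurable_energyTransfer_flow (Φ N) hχ1 h₁ h₁₂ hPac).const_mul c).neg.aestronglyMeasurable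
  have hDi : Integrable D μ := (hQi.const_mul (ℓ * L' / 2)).mono' hDm hdom
  refine ⟨hDi, ?_⟩
  calc |∫ z, D z ∂μ| ≤ ∫ z, ‖D z‖ ∂μ := by
        rw [← Real.norm_eq_abs]; exact norm_integral_le_integral_norm _
    _ ≤ ∫ z, (ℓ * L' / 2) * Q z ∂μ := integral_mono_ae hDi.norm (hQi.const_mul _) hdom
    _ = (ℓ * L' / 2) * ∫ z, Q z ∂μ := integral_const_mul _ _
    _ ≤ (ℓ * L' / 2) * C' :=
        mul_le_mul_of_nonneg_left (hQmean.trans (le_max_left _ _)) (by positivity)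
    _ ≤ ℓ * (L' * C') := by nlinarith [mul_nonneg hL'0 hC'0]
    _ ≤ ε := by
        rw [hℓdef, div_mul_eq_mul_div, div_le_iff₀ (by positivity)]
        nlinarith [mul_nonneg hL'0 hC'0]

end KEa2Glue

/-- Streaming energy-current mollification commutator (KE-a = KE-a1 + KE-a2; verbatim signature):
`E[cK^e_ψ − T^e_ψ] → 0`. -/
def StreamingEnergyCommutator : Prop := ∀ (a₀ θ₀ : Literature.MathematicalPhysics.KineticTheory.T3 → ℝ) (u₀ : Literature.MathematicalPhysics.KineticTheory.T3 → Literature.MathematicalPhysics.KineticTheory.V3), Continuous a₀ → Continuous θ₀ → Continuous u₀ → (∀ x, 0 < a₀ x) → (∀ x, 0 < θ₀ x) → ∃ σ₀ : ℝ, 0 < σ₀ ∧ ∀ σ : ℝ, 0 < σ → σ < σ₀ → ∀ Φ : (N : ℕ) → Literature.Analysis.FluidPDE.HardSphereFlow (Literature.Analysis.FluidPDE.Torus.geometry (Fin 3)) (Literature.MathematicalPhysics.KineticTheory.hsDiameter σ N) (N + 1), ∀ t₁ t₂ : ℝ, 0 ≤ t₁ → t₁ ≤ t₂ → ∀ ε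 : ℝ, 0 < ε → (∀ ψ : Literature.MathematicalPhysics.KineticTheory.T3 → ℝ, Literature.Analysis.FunctionSpaces.Torus.IsSmooth ψ → ∃ ℓ : ℝ, 0 < ℓ ∧ ∀ k : Literature.MathematicalPhysics.KineticTheory.T3 → ℝ, (Continuous k ∧ (∀ y, 0 ≤ k y) ∧ (∫ y, k y = 1) ∧ (∀ y, k y ≠ 0 → Literature.Analysis.FluidPDE.Torus.euclidDist y 0 < ℓ)) → ∀ᶠ N in Filter.atTop, ∀ D : Literature.Analysis.FluidPDE.Config (N + 1) (Fin 3) Literature.MathematicalPhysics.KineticTheory.T3 → ℝ, D = (fun z => ((N + 1 : ℕ) : ℝ)⁻¹ * (∫ s in t₁..t₂, Literature.Analysis.FluidPDE.energyStreaming ψ ((Φ N).flow s z)) - ∫ s in t₁..t₂, ∫ x, ((N + 1 : ℕ) : ℝ)⁻¹ * ∑ a, k (x - ((Φ N).flow s z a).1) * ((∑ i, ((Φ N).flow s z a).2 i * Literature.Analysis.FunctionSpaces.Torus.partialDeriv i ψ x) * (‖((Φ N).flow s z a).2‖ ^ 2 / 2))) → MeasureTheory.Integrable D (Literature.MathematicalPhysics.KineticTheory.localGibbsLaw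 σ a₀ u₀ θ₀ N (Φ N)) ∧ |∫ z, D z ∂Literature.MathematicalPhysics.KineticTheory.localGibbsLaw σ a₀ u₀ θ₀ N (Φ N)| ≤ ε)

/-- Signature of stub KE-b as a named proposition (verbatim). -/
def IdealEnergyCurrentClosure : Prop := ∀ (a₀ θ₀ : Literature.MathematicalPhysics.KineticTheory.T3 → ℝ) (u₀ : Literature.MathematicalPhysics.KineticTheory.T3 → Literature.MathematicalPhysics.KineticTheory.V3), Continuous a₀ → Continuous θ₀ → Continuous u₀ → (∀ x, 0 < a₀ x) → (∀ x, 0 < θ₀ x) → ∃ σ₀ : ℝ, 0 < σ₀ ∧ ∀ σ : ℝ, 0 < σ → σ < σ₀ → ∀ Φ : (N : ℕ) → Literature.Analysis.FluidPDE.HardSphereFlow (Literature.Analysis.FluidPDE.Torus.geometry (Fin 3)) (Literature.MathematicalPhysics.KineticTheory.hsDiameter σ N) (N + 1), ∀ t₁ t₂ : ℝ, 0 ≤ t₁ → t₁ ≤ t₂ → ∀ ε : ℝ, 0 < ε → (∀ ψ : Literature.MathematicalPhysics.KineticTheory.T3 → ℝ, Literature.Analysis.FunctionSpaces.Torus.IsSmooth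 ψ → ∃ ℓ : ℝ, 0 < ℓ ∧ ∀ k : Literature.MathematicalPhysics.KineticTheory.T3 → ℝ, (Continuous k ∧ (∀ y, 0 ≤ k y) ∧ (∫ y, k y = 1) ∧ (∀ y, k y ≠ 0 → Literature.Analysis.FluidPDE.Torus.euclidDist y 0 < ℓ)) → ∀ᶠ N in Filter.atTop, ∀ D : Literature.Analysis.FluidPDE.Config (N + 1) (Fin 3) Literature.MathematicalPhysics.KineticTheory.T3 → ℝ, D = (fun z => (∫ s in t₁..t₂, ∫ x, ((N + 1 : ℕ) : ℝ)⁻¹ * ∑ a, k (x - ((Φ N).flow s z a).1) * ((∑ i, ((Φ N).flow s z a).2 i * Literature.Analysis.FunctionSpaces.Torus.partialDeriv i ψ x) * (‖((Φ N).flow s z a).2‖ ^ 2 / 2))) - (∫ s in t₁..t₂, ∫ x, (((Literature.MathematicalPhysics.KineticTheory.empiricalEnergyField ((Φ N).flow s z) (fun y => k (x - y)) + Literature.MathematicalPhysics.KineticTheory.empiricalDensityField ((Φ N).flow s z) (fun y => k (x - y)) * (2 / 3 * (Literature.MathematicalPhysics.KineticTheory.empiricalEnergyField ((Φ N).flow s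 z) (fun y => k (x - y)) / Literature.MathematicalPhysics.KineticTheory.empiricalDensityField ((Φ N).flow s z) (fun y => k (x - y)) - ‖Literature.MathematicalPhysics.KineticTheory.empiricalMomentumField ((Φ N).flow s z) (fun y => k (x - y))‖ ^ 2 / (2 * Literature.MathematicalPhysics.KineticTheory.empiricalDensityField ((Φ N).flow s z) (fun y => k (x - y)) ^ 2)))) / Literature.MathematicalPhysics.KineticTheory.empiricalDensityField ((Φ N).flow s z) (fun y => k (x - y))) * (∑ i, Literature.MathematicalPhysics.KineticTheory.empiricalMomentumField ((Φ N).flow s z) (fun y => k (x - y)) i * Literature.Analysis.FunctionSpaces.Torus.partialDeriv i ψ x)))) → MeasureTheory.Integrable D (Literature.MathematicalPhysics.KineticTheory.localGibbsLaw σ a₀ u₀ θ₀ N (Φ N)) ∧ |∫ z, D z ∂Literature.MathematicalPhysics.KineticTheory.localGibbsLaw σ a₀ u₀ θ₀ N (Φ N)| ≤ ε)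

/-- Mean kinetic energy-current closure (KE = KE-a + KE-b): the kinetic energy current tested with ∇ψ
closes in mean on the ideal enthalpy flux of the mollified fields (verbatim signature). -/
def KineticEnergyCurrentClosure : Prop := ∀ (a₀ θ₀ : Literature.MathematicalPhysics.KineticTheory.T3 → ℝ) (u₀ : Literature.MathematicalPhysics.KineticTheory.T3 → Literature.MathematicalPhysics.KineticTheory.V3), Continuous a₀ → Continuous θ₀ → Continuous u₀ → (∀ x, 0 < a₀ x) → (∀ x, 0 < θ₀ x) → ∃ σ₀ : ℝ, 0 < σ₀ ∧ ∀ σ : ℝ, 0 < σ → σ < σ₀ → ∀ Φ : (N : ℕ) → Literature.Analysis.FluidPDE.HardSphereFlow (Literature.Analysis.FluidPDE.Torus.geometry (Fin 3)) (Literature.MathematicalPhysics.KineticTheory.hsDiameter σ N) (N + 1), ∀ t₁ t₂ : ℝ, 0 ≤ t₁ → t₁ ≤ t₂ → ∀ ε : ℝ, 0 < ε → (∀ ψ : Literature.MathematicalPhysics.KineticTheory.T3 → ℝ, Literature.Analysis.FunctionSpaces.Torus.IsSmooth ψ → ∃ ℓ : ℝ, 0 < ℓ ∧ ∀ k : Literature.MathematicalPhysics.KineticTheory.T3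 → ℝ, (Continuous k ∧ (∀ y, 0 ≤ k y) ∧ (∫ y, k y = 1) ∧ (∀ y, k y ≠ 0 → Literature.Analysis.FluidPDE.Torus.euclidDist y 0 < ℓ)) → ∀ᶠ N in Filter.atTop, ∀ D : Literature.Analysis.FluidPDE.Config (N + 1) (Fin 3) Literature.MathematicalPhysics.KineticTheory.T3 → ℝ, D = (fun z => ((N + 1 : ℕ) : ℝ)⁻¹ * (∫ s in t₁..t₂, Literature.Analysis.FluidPDE.energyStreaming ψ ((Φ N).flow s z)) - ∫ s in t₁..t₂, ∫ x, (((Literature.MathematicalPhysics.KineticTheory.empiricalEnergyField ((Φ N).flow s z) (fun y => k (x - y)) + Literature.MathematicalPhysics.KineticTheory.empiricalDensityField ((Φ N).flow s z) (fun y => k (x - y)) * (2 / 3 * (Literature.MathematicalPhysics.KineticTheory.empiricalEnergyField ((Φ N).flow s z) (fun y => k (x - y)) / Literature.MathematicalPhysics.KineticTheory.empiricalDensityField ((Φ N).flow s z) (fun y => k (x - y)) - ‖Literature.MathematicalPhysics.KineticTheory.empiricalMomentumField ((Φ N).flow s z) (fun y => k (x - y))‖ ^ 2 / (2 * Literature.MathematicalPhysics.KineticTheory.empiricalDensityField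 ((Φ N).flow s z) (fun y => k (x - y)) ^ 2)))) / Literature.MathematicalPhysics.KineticTheory.empiricalDensityField ((Φ N).flow s z) (fun y => k (x - y))) * (∑ i, Literature.MathematicalPhysics.KineticTheory.empiricalMomentumField ((Φ N).flow s z) (fun y => k (x - y)) i * Literature.Analysis.FunctionSpaces.Torus.partialDeriv i ψ x))) → MeasureTheory.Integrable D (Literature.MathematicalPhysics.KineticTheory.localGibbsLaw σ a₀ u₀ θ₀ N (Φ N)) ∧ |∫ z, D z ∂Literature.MathematicalPhysics.KineticTheory.localGibbsLaw σ a₀ u₀ θ₀ N (Φ N)| ≤ ε)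

/-- Signature of stub CE as a named proposition (verbatim). -/
def CollisionalEnergyCurrentClosure : Prop := ∀ (a₀ θ₀ : Literature.MathematicalPhysics.KineticTheory.T3 → ℝ) (u₀ : Literature.MathematicalPhysics.KineticTheory.T3 → Literature.MathematicalPhysics.KineticTheory.V3), Continuous a₀ → Continuous θ₀ → Continuous u₀ → (∀ x, 0 < a₀ x) → (∀ x, 0 < θ₀ x) → ∃ σ₀ : ℝ, 0 < σ₀ ∧ ∀ σ : ℝ, 0 < σ → σ < σ₀ → ∀ Φ : (N : ℕ) → Literature.Analysis.FluidPDE.HardSphereFlow (Literature.Analysis.FluidPDE.Torus.geometry (Fin 3)) (Literature.MathematicalPhysics.KineticTheory.hsDiameter σ N) (N + 1), ∀ t₁ t₂ : ℝ, 0 ≤ t₁ → t₁ ≤ t₂ → ∀ ε : ℝ, 0 < ε → (∀ ψ : Literature.MathematicalPhysics.KineticTheory.T3 → ℝ, Literature.Analysis.FunctionSpaces.Torus.IsSmooth ψ → ∃ ℓ : ℝ, 0 < ℓ ∧ ∀ k : Literature.MathematicalPhysics.KineticTheory.T3 → ℝ, (Continuous k ∧ (∀ y, 0 ≤ k y) ∧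 (∫ y, k y = 1) ∧ (∀ y, k y ≠ 0 → Literature.Analysis.FluidPDE.Torus.euclidDist y 0 < ℓ)) → ∀ᶠ N in Filter.atTop, ∀ D : Literature.Analysis.FluidPDE.Config (N + 1) (Fin 3) Literature.MathematicalPhysics.KineticTheory.T3 → ℝ, D = (fun z => ((N + 1 : ℕ) : ℝ)⁻¹ * (Φ N).energyTransfer ψ ((Φ N).flow t₁ z) (t₂ - t₁) + (∫ s in t₁..t₂, ∫ x, (((Literature.MathematicalPhysics.KineticTheory.empiricalEnergyField ((Φ N).flow s z) (fun y => k (x - y)) + Literature.MathematicalPhysics.KineticTheory.empiricalDensityField ((Φ N).flow s z) (fun y => k (x - y)) * (2 / 3 * (Literature.MathematicalPhysics.KineticTheory.empiricalEnergyField ((Φ N).flow s z) (fun y => k (x - y)) / Literature.MathematicalPhysics.KineticTheory.empiricalDensityField ((Φ N).flow s z) (fun y => k (x - y)) - ‖Literature.MathematicalPhysics.KineticTheory.empiricalMomentumField ((Φ N).flow s z) (fun y => k (x - y))‖ ^ 2 / (2 * Literature.MathematicalPhysics.KineticTheory.empiricalDensityField ((Φ N).flow s z) (fun y => k (x - y))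 ^ 2)))) / Literature.MathematicalPhysics.KineticTheory.empiricalDensityField ((Φ N).flow s z) (fun y => k (x - y))) * (∑ i, Literature.MathematicalPhysics.KineticTheory.empiricalMomentumField ((Φ N).flow s z) (fun y => k (x - y)) i * Literature.Analysis.FunctionSpaces.Torus.partialDeriv i ψ x))) - (∫ s in t₁..t₂, ∫ x, (((Literature.MathematicalPhysics.KineticTheory.empiricalEnergyField ((Φ N).flow s z) (fun y => k (x - y)) + Literature.MathematicalPhysics.KineticTheory.hsPressure σ (Literature.MathematicalPhysics.KineticTheory.empiricalDensityField ((Φ N).flow s z) (fun y => k (x - y))) (2 / 3 * (Literature.MathematicalPhysics.KineticTheory.empiricalEnergyField ((Φ N).flow s z) (fun y => k (x - y)) / Literature.MathematicalPhysics.KineticTheory.empiricalDensityField ((Φ N).flow s z) (fun y => k (x - y)) - ‖Literature.MathematicalPhysics.KineticTheory.empiricalMomentumField ((Φ N).flow s z) (fun y => k (x - y))‖ ^ 2 / (2 * Literature.MathematicalPhysics.KineticTheory.empiricalDensityField ((Φ N).flow s z) (fun y => k (x - y)) ^ 2)))) / Literature.MathematicalPhysics.KineticTheory.empiricalDensityField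 ((Φ N).flow s z) (fun y => k (x - y))) * (∑ i, Literature.MathematicalPhysics.KineticTheory.empiricalMomentumField ((Φ N).flow s z) (fun y => k (x - y)) i * Literature.Analysis.FunctionSpaces.Torus.partialDeriv i ψ x)))) → MeasureTheory.Integrable D (Literature.MathematicalPhysics.KineticTheory.localGibbsLaw σ a₀ u₀ θ₀ N (Φ N)) ∧ |∫ z, D z ∂Literature.MathematicalPhysics.KineticTheory.localGibbsLaw σ a₀ u₀ θ₀ N (Φ N)| ≤ ε)

/-- Signature of the planner's stub E (mean energy-flux closure; first conjunct of the crux) as a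
named proposition (verbatim). -/
def EnergyFluxClosure : Prop := ∀ (a₀ θ₀ : Literature.MathematicalPhysics.KineticTheory.T3 → ℝ) (u₀ : Literature.MathematicalPhysics.KineticTheory.T3 → Literature.MathematicalPhysics.KineticTheory.V3), Continuous a₀ → Continuous θ₀ → Continuous u₀ → (∀ x, 0 < a₀ x) → (∀ x, 0 < θ₀ x) → ∃ σ₀ : ℝ, 0 < σ₀ ∧ ∀ σ : ℝ, 0 < σ → σ < σ₀ → ∀ Φ : (N : ℕ) → Literature.Analysis.FluidPDE.HardSphereFlow (Literature.Analysis.FluidPDE.Torus.geometry (Fin 3)) (Literature.MathematicalPhysics.KineticTheory.hsDiameter σ N) (N + 1), ∀ t₁ t₂ : ℝ, 0 ≤ t₁ → t₁ ≤ t₂ → ∀ ε : ℝ, 0 < ε → (∀ ψ : Literature.MathematicalPhysics.KineticTheory.T3 → ℝ, Literature.Analysis.FunctionSpaces.Torus.IsSmooth ψ → ∃ ℓ : ℝ, 0 < ℓ ∧ ∀ k : Literature.MathematicalPhysics.KineticTheory.T3 → ℝ, (Continuous k ∧ (∀ y, 0 ≤ k y) ∧ (∫ y, k y = 1) ∧ (∀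 y, k y ≠ 0 → Literature.Analysis.FluidPDE.Torus.euclidDist y 0 < ℓ)) → ∀ᶠ N in Filter.atTop, let D : Literature.Analysis.FluidPDE.Config (N + 1) (Fin 3) Literature.MathematicalPhysics.KineticTheory.T3 → ℝ := fun z => (Literature.MathematicalPhysics.KineticTheory.empiricalEnergyField ((Φ N).flow t₂ z) ψ - Literature.MathematicalPhysics.KineticTheory.empiricalEnergyField ((Φ N).flow t₁ z) ψ) - ∫ s in t₁..t₂, ∫ x, (let R : ℝ := Literature.MathematicalPhysics.KineticTheory.empiricalDensityField ((Φ N).flow s z) (fun y => k (x - y)); let Mv : Literature.MathematicalPhysics.KineticTheory.V3 := Literature.MathematicalPhysics.KineticTheory.empiricalMomentumField ((Φ N).flow s z) (fun y => k (x - y)); let En : ℝ := Literature.MathematicalPhysics.KineticTheory.empiricalEnergyField ((Φ N).flow s z) (fun y => k (x - y)); let Θ : ℝ := 2 / 3 * (En / R - ‖Mv‖ ^ 2 / (2 * R ^ 2)); let Pr : ℝ := Literature.MathematicalPhysics.KineticTheory.hsPressure σ R Θ; ((En + Pr) / R) * (∑ i, Mv i * Literature.Analysis.FunctionSpaces.Torus.partialDeriv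 i ψ x)); MeasureTheory.Integrable D (Literature.MathematicalPhysics.KineticTheory.localGibbsLaw σ a₀ u₀ θ₀ N (Φ N)) ∧ |∫ z, D z ∂Literature.MathematicalPhysics.KineticTheory.localGibbsLaw σ a₀ u₀ θ₀ N (Φ N)| ≤ ε)

/-- Signature of stub CE' as a named proposition (verbatim). -/
def CollisionalEnergyContactClosure : Prop := ∀ (a₀ θ₀ : Literature.MathematicalPhysics.KineticTheory.T3 → ℝ) (u₀ : Literature.MathematicalPhysics.KineticTheory.T3 → Literature.MathematicalPhysics.KineticTheory.V3), Continuous a₀ → Continuous θ₀ → Continuous u₀ → (∀ x, 0 < a₀ x) → (∀ x, 0 < θ₀ x) → ∃ σ₀ : ℝ, 0 < σ₀ ∧ ∀ σ : ℝ, 0 < σ → σ < σ₀ → ∀ Φ : (N : ℕ) → Literature.Analysis.FluidPDE.HardSphereFlow (Literature.Analysis.FluidPDE.Torus.geometry (Fin 3)) (Literature.MathematicalPhysics.KineticTheory.hsDiameter σ N) (N + 1), ∀ t₁ t₂ : ℝ, 0 ≤ t₁ → t₁ ≤ t₂ → ∀ ε : ℝ, 0 < ε → (∀ ψ : Literature.MathematicalPhysics.KineticTheory.T3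 → ℝ, Literature.Analysis.FunctionSpaces.Torus.IsSmooth ψ → ∃ ℓ : ℝ, 0 < ℓ ∧ ∀ k : Literature.MathematicalPhysics.KineticTheory.T3 → ℝ, (Continuous k ∧ (∀ y, 0 ≤ k y) ∧ (∫ y, k y = 1) ∧ (∀ y, k y ≠ 0 → Literature.Analysis.FluidPDE.Torus.euclidDist y 0 < ℓ)) → ∀ᶠ N in Filter.atTop, ∀ D : Literature.Analysis.FluidPDE.Config (N + 1) (Fin 3) Literature.MathematicalPhysics.KineticTheory.T3 → ℝ, D = (fun z => ((N + 1 : ℕ) : ℝ)⁻¹ * (Φ N).collisionalTransferFunctional (fun (i j : Fin (N + 1)) (pre post : Literature.Analysis.FluidPDE.Config (N + 1) (Fin 3) Literature.MathematicalPhysics.KineticTheory.T3) => 2⁻¹ * (Literature.Analysis.FunctionSpaces.Torus.fderiv ψ (post i).1 ((Literature.Analysis.FluidPDE.Torus.geometry (Fin 3)).sepVec (post i).1 (post j).1) * ((‖(post i).2‖ ^ 2 - ‖(pre i).2‖ ^ 2) / 2))) ((Φ N).flow t₁ z) (t₂ - t₁) + (∫ s in t₁..t₂, ∫ x, (((Literature.MathematicalPhysics.KineticTheory.empiricalEnergyField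 ((Φ N).flow s z) (fun y => k (x - y)) + Literature.MathematicalPhysics.KineticTheory.empiricalDensityField ((Φ N).flow s z) (fun y => k (x - y)) * (2 / 3 * (Literature.MathematicalPhysics.KineticTheory.empiricalEnergyField ((Φ N).flow s z) (fun y => k (x - y)) / Literature.MathematicalPhysics.KineticTheory.empiricalDensityField ((Φ N).flow s z) (fun y => k (x - y)) - ‖Literature.MathematicalPhysics.KineticTheory.empiricalMomentumField ((Φ N).flow s z) (fun y => k (x - y))‖ ^ 2 / (2 * Literature.MathematicalPhysics.KineticTheory.empiricalDensityField ((Φ N).flow s z) (fun y => k (x - y)) ^ 2)))) / Literature.MathematicalPhysics.KineticTheory.empiricalDensityField ((Φ N).flow s z) (fun y => k (x - y))) * (∑ i, Literature.MathematicalPhysics.KineticTheory.empiricalMomentumField ((Φ N).flow s z) (fun y => k (x - y)) i * Literature.Analysis.FunctionSpaces.Torus.partialDeriv i ψ x))) - (∫ s in t₁..t₂, ∫ x, (((Literature.MathematicalPhysics.KineticTheory.empiricalEnergyField ((Φ N).flow s z) (fun y => k (x - y)) + Literature.MathematicalPhysics.KineticTheory.hsPressure σ (Literature.MathematicalPhysics.KineticTheory.empiricalDensityField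 ((Φ N).flow s z) (fun y => k (x - y))) (2 / 3 * (Literature.MathematicalPhysics.KineticTheory.empiricalEnergyField ((Φ N).flow s z) (fun y => k (x - y)) / Literature.MathematicalPhysics.KineticTheory.empiricalDensityField ((Φ N).flow s z) (fun y => k (x - y)) - ‖Literature.MathematicalPhysics.KineticTheory.empiricalMomentumField ((Φ N).flow s z) (fun y => k (x - y))‖ ^ 2 / (2 * Literature.MathematicalPhysics.KineticTheory.empiricalDensityField ((Φ N).flow s z) (fun y => k (x - y)) ^ 2)))) / Literature.MathematicalPhysics.KineticTheory.empiricalDensityField ((Φ N).flow s z) (fun y => k (x - y))) * (∑ i, Literature.MathematicalPhysics.KineticTheory.empiricalMomentumField ((Φ N).flow s z) (fun y => k (x - y)) i * Literature.Analysis.FunctionSpaces.Torus.partialDeriv i ψ x)))) → MeasureTheory.Integrable D (Literature.MathematicalPhysics.KineticTheory.localGibbsLaw σ a₀ u₀ θ₀ N (Φ N)) ∧ |∫ z, D z ∂Literature.MathematicalPhysics.KineticTheory.localGibbsLaw σ a₀ u₀ θ₀ N (Φ N)| ≤ ε)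

/-- **GLUE CE (sorry-free): FLUX + CE' ⇒ CE**, through the LANDED contact-remainder theorem
`Summit.AtomisticToContinuum.HydrodynamicLimit.Theorems.stub_collisionalEnergyContactRemainder` (worker CE, p148524).
Pointwise `cW^e + J − I = c(W^e − W^{contact}) + (cW^{contact} + J − I)`; the first summand has `∫|·| ≤ ε/2`
eventually in N (FLUX mean bound + `σ_N → 0`), the second is CE' with ε/2; `σ₀ := min (min σ₁ σ₂) (1/2)`. -/
theorem flux_contact_imply_collisionalEnergyCurrentClosure :
    CollisionEnergyExchangeMeanBound → CollisionalEnergyContactClosure → CollisionalEnergyCurrentClosure := by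
  unfold CollisionEnergyExchangeMeanBound CollisionalEnergyContactClosure CollisionalEnergyCurrentClosure
  intro hF hCE a₀ θ₀ u₀ ha hθ hu hap hθp
  obtain ⟨σ₁, hσ₁, H1⟩ := hF a₀ θ₀ u₀ ha hθ hu hap hθp
  obtain ⟨σ₂, hσ₂, H2⟩ := hCE a₀ θ₀ u₀ ha hθ hu hap hθp
  refine ⟨min (min σ₁ σ₂) (1 / 2), lt_min (lt_min hσ₁ hσ₂) one_half_pos, ?_⟩
  intro σ hσ hσlt Φ t₁ t₂ h₁ h₁₂ ε hε ψ hψ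
  have hσ1 : σ < σ₁ := lt_of_lt_of_le hσlt ((min_le_left _ _).trans (min_le_left _ _))
  have hσ2 : σ < σ₂ := lt_of_lt_of_le hσlt ((min_le_left _ _).trans (min_le_right _ _))
  have hσh : σ < 1 / 2 := lt_of_lt_of_le hσlt (min_le_right _ _)
  obtain ⟨C', hC'⟩ := H1 σ hσ hσ1 Φ t₁ t₂ h₁ h₁₂
  obtain ⟨ℓ, hℓ, K2⟩ := H2 σ hσ hσ2 Φ t₁ t₂ h₁ h₁₂ (ε / 2) (half_pos hε) ψ hψ
  refine ⟨ℓ, hℓ, fun k hk => ?_⟩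
  have hψ2 : Torus.IsContDiff 2 ψ := hψ.isContDiff (WithTop.coe_le_coe.2 le_top)
  have hrem := Summit.AtomisticToContinuum.HydrodynamicLimit.Theorems.stub_collisionalEnergyContactRemainder σ hσ hσh
    a₀ θ₀ u₀ Φ ψ hψ2 t₁ t₂ C' (hC'.mono fun N hN => hN _ rfl) (ε / 2) (half_pos hε)
  filter_upwards [hrem, K2 k hk] with N hNr hN2
  intro D hD
  subst hD
  refine integrable_and_abs_integral_le_of_ae_eq_add (Eventually.of_forall fun z => ?_)
    ⟨hNr.1, (abs_integral_le_integral_abs).trans hNr.2⟩ (hN2 _ rfl)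
  ring

/-- Stub CE, now a THEOREM of the skeleton from stubs FLUX and CE' (and the landed contact remainder). -/
theorem stub_collisionalEnergyCurrentClosure : ∀ (a₀ θ₀ : Literature.MathematicalPhysics.KineticTheory.T3 → ℝ) (u₀ : Literature.MathematicalPhysics.KineticTheory.T3 → Literature.MathematicalPhysics.KineticTheory.V3), Continuous a₀ → Continuous θ₀ → Continuous u₀ → (∀ x, 0 < a₀ x) → (∀ x, 0 < θ₀ x) → ∃ σ₀ : ℝ, 0 < σ₀ ∧ ∀ σ : ℝ, 0 < σ → σ < σ₀ → ∀ Φ : (N : ℕ) → Literature.Analysis.FluidPDE.HardSphereFlow (Literature.Analysis.FluidPDE.Torus.geometry (Fin 3)) (Literature.MathematicalPhysics.KineticTheory.hsDiameter σ N) (N + 1), ∀ t₁ t₂ : ℝ, 0 ≤ t₁ → t₁ ≤ t₂ → ∀ ε : ℝ, 0 < ε → (∀ ψ : Literature.MathematicalPhysics.KineticTheory.T3 → ℝ, Literature.Analysis.FunctionSpaces.Torus.IsSmooth ψ → ∃ ℓ : ℝ, 0 < ℓ ∧ ∀ k : Literature.MathematicalPhysics.KineticTheory.T3 → ℝ, (Continuous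 k ∧ (∀ y, 0 ≤ k y) ∧ (∫ y, k y = 1) ∧ (∀ y, k y ≠ 0 → Literature.Analysis.FluidPDE.Torus.euclidDist y 0 < ℓ)) → ∀ᶠ N in Filter.atTop, ∀ D : Literature.Analysis.FluidPDE.Config (N + 1) (Fin 3) Literature.MathematicalPhysics.KineticTheory.T3 → ℝ, D = (fun z => ((N + 1 : ℕ) : ℝ)⁻¹ * (Φ N).energyTransfer ψ ((Φ N).flow t₁ z) (t₂ - t₁) + (∫ s in t₁..t₂, ∫ x, (((Literature.MathematicalPhysics.KineticTheory.empiricalEnergyField ((Φ N).flow s z) (fun y => k (x - y)) + Literature.MathematicalPhysics.KineticTheory.empiricalDensityField ((Φ N).flow s z) (fun y => k (x - y)) * (2 / 3 * (Literature.MathematicalPhysics.KineticTheory.empiricalEnergyField ((Φ N).flow s z) (fun y => k (x - y)) / Literature.MathematicalPhysics.KineticTheory.empiricalDensityField ((Φ N).flow s z) (fun y => k (x - y)) - ‖Literature.MathematicalPhysics.KineticTheory.empiricalMomentumField ((Φ N).flow s z) (fun y => k (x - y))‖ ^ 2 / (2 * Literature.MathematicalPhysics.KineticTheory.empiricalDensityField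 ((Φ N).flow s z) (fun y => k (x - y)) ^ 2)))) / Literature.MathematicalPhysics.KineticTheory.empiricalDensityField ((Φ N).flow s z) (fun y => k (x - y))) * (∑ i, Literature.MathematicalPhysics.KineticTheory.empiricalMomentumField ((Φ N).flow s z) (fun y => k (x - y)) i * Literature.Analysis.FunctionSpaces.Torus.partialDeriv i ψ x))) - (∫ s in t₁..t₂, ∫ x, (((Literature.MathematicalPhysics.KineticTheory.empiricalEnergyField ((Φ N).flow s z) (fun y => k (x - y)) + Literature.MathematicalPhysics.KineticTheory.hsPressure σ (Literature.MathematicalPhysics.KineticTheory.empiricalDensityField ((Φ N).flow s z) (fun y => k (x - y))) (2 / 3 * (Literature.MathematicalPhysics.KineticTheory.empiricalEnergyField ((Φ N).flow s z) (fun y => k (x - y)) / Literature.MathematicalPhysics.KineticTheory.empiricalDensityField ((Φ N).flow s z) (fun y => k (x - y)) - ‖Literature.MathematicalPhysics.KineticTheory.empiricalMomentumField ((Φ N).flow s z) (fun y => k (x - y))‖ ^ 2 / (2 * Literature.MathematicalPhysics.KineticTheory.empiricalDensityField ((Φ N).flow s z) (fun y => k (x - y)) ^ 2)))) / Literature.MathematicalPhysics.KineticTheory.empiricalDensityField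 ((Φ N).flow s z) (fun y => k (x - y))) * (∑ i, Literature.MathematicalPhysics.KineticTheory.empiricalMomentumField ((Φ N).flow s z) (fun y => k (x - y)) i * Literature.Analysis.FunctionSpaces.Torus.partialDeriv i ψ x)))) → MeasureTheory.Integrable D (Literature.MathematicalPhysics.KineticTheory.localGibbsLaw σ a₀ u₀ θ₀ N (Φ N)) ∧ |∫ z, D z ∂Literature.MathematicalPhysics.KineticTheory.localGibbsLaw σ a₀ u₀ θ₀ N (Φ N)| ≤ ε) := by
  have h := flux_contact_imply_collisionalEnergyCurrentClosure
  unfold CollisionEnergyExchangeMeanBound CollisionalEnergyContactClosure CollisionalEnergyCurrentClosure at h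
  exact h stub_collisionEnergyExchangeMeanBound stub_collisionalEnergyContactClosure

/-- **GLUE KS (sorry-free): commutator + deviatoric closure ⇒ kinetic-stress closure.** The two
functionals add up POINTWISE to the kinetic-stress functional (the mollified-stress term cancels);
thresholds merge by `min`, ε splits in halves. -/
theorem commutator_deviatoric_imply_kineticStressClosure :
    StreamingStressCommutator → DeviatoricStressClosure → KineticStressClosure := by
  unfold StreamingStressCommutator DeviatoricStressClosure KineticStressClosure
  intro hA hB a₀ θ₀ u₀ ha hθ hu hap hθp
  obtain ⟨σ₁, hσ₁, H1⟩ := hA a₀ θ₀ u₀ ha hθ hu hap hθp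
  obtain ⟨σ₂, hσ₂, H2⟩ := hB a₀ θ₀ u₀ ha hθ hu hap hθp
  refine ⟨min σ₁ σ₂, lt_min hσ₁ hσ₂, ?_⟩
  intro σ hσ hσlt Φ t₁ t₂ h₁ h₁₂ ε hε φ hφ
  obtain ⟨ℓ₁, hℓ₁, K1⟩ := H1 σ hσ (lt_of_lt_of_le hσlt (min_le_left σ₁ σ₂)) Φ t₁ t₂ h₁ h₁₂ (ε / 2)
    (half_pos hε) φ hφ
  obtain ⟨ℓ₂, hℓ₂, K2⟩ := H2 σ hσ (lt_of_lt_of_le hσlt (min_le_right σ₁ σ₂)) Φ t₁ t₂ h₁ h₁₂ (ε / 2)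
    (half_pos hε) φ hφ
  refine ⟨min ℓ₁ ℓ₂, lt_min hℓ₁ hℓ₂, fun k hk => ?_⟩
  filter_upwards [K1 k (kernel_mono (min_le_left ℓ₁ ℓ₂) hk),
    K2 k (kernel_mono (min_le_right ℓ₁ ℓ₂) hk)] with N hN1 hN2
  intro D hD
  subst hD
  refine integrable_and_abs_integral_le_of_ae_eq_add (Eventually.of_forall fun z => ?_) (hN1 _ rfl) (hN2 _ rfl)
  ring

/-- **GLUE KE (sorry-free): commutator + ideal energy-current closure ⇒ kinetic energy-current closure**
(energy twin of `commutator_deviatoric_imply_kineticStressClosure`). -/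
theorem commutator_ideal_imply_kineticEnergyCurrentClosure :
    StreamingEnergyCommutator → IdealEnergyCurrentClosure → KineticEnergyCurrentClosure := by
  unfold StreamingEnergyCommutator IdealEnergyCurrentClosure KineticEnergyCurrentClosure
  intro hA hB a₀ θ₀ u₀ ha hθ hu hap hθp
  obtain ⟨σ₁, hσ₁, H1⟩ := hA a₀ θ₀ u₀ ha hθ hu hap hθp
  obtain ⟨σ₂, hσ₂, H2⟩ := hB a₀ θ₀ u₀ ha hθ hu hap hθp
  refine ⟨min σ₁ σ₂, lt_min hσ₁ hσ₂, ?_⟩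
  intro σ hσ hσlt Φ t₁ t₂ h₁ h₁₂ ε hε ψ hψ
  obtain ⟨ℓ₁, hℓ₁, K1⟩ := H1 σ hσ (lt_of_lt_of_le hσlt (min_le_left σ₁ σ₂)) Φ t₁ t₂ h₁ h₁₂ (ε / 2)
    (half_pos hε) ψ hψ
  obtain ⟨ℓ₂, hℓ₂, K2⟩ := H2 σ hσ (lt_of_lt_of_le hσlt (min_le_right σ₁ σ₂)) Φ t₁ t₂ h₁ h₁₂ (ε / 2)
    (half_pos hε) ψ hψ
  refine ⟨min ℓ₁ ℓ₂, lt_min hℓ₁ hℓ₂, fun k hk => ?_⟩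
  filter_upwards [K1 k (kernel_mono (min_le_left ℓ₁ ℓ₂) hk),
    K2 k (kernel_mono (min_le_right ℓ₁ ℓ₂) hk)] with N hN1 hN2
  intro D hD
  subst hD
  refine integrable_and_abs_integral_le_of_ae_eq_add (Eventually.of_forall fun z => ?_) (hN1 _ rfl) (hN2 _ rfl)
  ring

/-- **GLUE KE-a (sorry-free): boundary part + collision part ⇒ streaming energy commutator**
(pointwise additivity). -/
theorem boundary_collisions_imply_streamingEnergyCommutator :
    EnergyCommutatorBoundary → EnergyCommutatorCollisions → StreamingEnergyCommutator := by
  unfold EnergyCommutatorBoundary EnergyCommutatorCollisions StreamingEnergyCommutator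
  intro hA hB a₀ θ₀ u₀ ha hθ hu hap hθp
  obtain ⟨σ₁, hσ₁, H1⟩ := hA a₀ θ₀ u₀ ha hθ hu hap hθp
  obtain ⟨σ₂, hσ₂, H2⟩ := hB a₀ θ₀ u₀ ha hθ hu hap hθp
  refine ⟨min σ₁ σ₂, lt_min hσ₁ hσ₂, ?_⟩
  intro σ hσ hσlt Φ t₁ t₂ h₁ h₁₂ ε hε ψ hψ
  obtain ⟨ℓ₁, hℓ₁, K1⟩ := H1 σ hσ (lt_of_lt_of_le hσlt (min_le_left σ₁ σ₂)) Φ t₁ t₂ h₁ h₁₂ (ε / 2)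
    (half_pos hε) ψ hψ
  obtain ⟨ℓ₂, hℓ₂, K2⟩ := H2 σ hσ (lt_of_lt_of_le hσlt (min_le_right σ₁ σ₂)) Φ t₁ t₂ h₁ h₁₂ (ε / 2)
    (half_pos hε) ψ hψ
  refine ⟨min ℓ₁ ℓ₂, lt_min hℓ₁ hℓ₂, fun k hk => ?_⟩
  filter_upwards [K1 k (kernel_mono (min_le_left ℓ₁ ℓ₂) hk),
    K2 k (kernel_mono (min_le_right ℓ₁ ℓ₂) hk)] with N hN1 hN2
  intro D hD
  subst hD
  refine integrable_and_abs_integral_le_of_ae_eq_add (Eventually.of_forall fun z => ?_) (hN1 _ rfl) (hN2 _ rfl)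
  ring

/-- Streaming energy commutator (KE-a), a THEOREM of the skeleton from stubs KE-a1 and KE-a2. -/
theorem streamingEnergyCommutator : StreamingEnergyCommutator :=
  boundary_collisions_imply_streamingEnergyCommutator
    (by have h : EnergyCommutatorBoundary := by
          unfold EnergyCommutatorBoundary; exact stub_energyCommutatorBoundary
        exact h)
    (flux_imply_energyCommutatorCollisions (by
      have h : CollisionEnergyExchangeMeanBound := by
        unfold CollisionEnergyExchangeMeanBound; exact stub_collisionEnergyExchangeMeanBound
      exact h))

/-- Mean kinetic-stress closure (KS), a THEOREM of the skeleton from stubs KS-a and KS-b. -/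
theorem kineticStressClosure : KineticStressClosure :=
  commutator_deviatoric_imply_kineticStressClosure
    (by have h : StreamingStressCommutator := by
          unfold StreamingStressCommutator; exact stub_streamingStressCommutator
        exact h)
    (by have h : DeviatoricStressClosure := by
          unfold DeviatoricStressClosure; exact stub_deviatoricStressClosure
        exact h)

/-- Mean kinetic energy-current closure (KE), a THEOREM of the skeleton from stubs KE-a and KE-b. -/
theorem kineticEnergyCurrentClosure : KineticEnergyCurrentClosure :=
  commutator_ideal_imply_kineticEnergyCurrentClosure
    streamingEnergyCommutator
    (by have h : IdealEnergyCurrentClosure := by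
          unfold IdealEnergyCurrentClosure; exact stub_idealEnergyCurrentClosure
        exact h)

/-- **GLUE M (sorry-free): kinetic-stress closure + collisional-stress closure ⇒ mean momentum-flux
closure.** On the good set the pathwise momentum balance gives `ΔM = (N+1)⁻¹(K + W)`, hence the crux
defect is `(cK − J) + (cW + J − I)`; the good set is conull for the local Gibbs law; thresholds merge
by `min`, ε splits in halves. -/
theorem kinetic_collisional_imply_momentumFluxClosure :
    KineticStressClosure → CollisionalStressClosure → MomentumFluxClosure := by
  unfold KineticStressClosure CollisionalStressClosure MomentumFluxClosure
  intro hKS hCS a₀ θ₀ u₀ ha hθ hu hap hθp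
  obtain ⟨σ₁, hσ₁, H1⟩ := hKS a₀ θ₀ u₀ ha hθ hu hap hθp
  obtain ⟨σ₂, hσ₂, H2⟩ := hCS a₀ θ₀ u₀ ha hθ hu hap hθp
  refine ⟨min σ₁ σ₂, lt_min hσ₁ hσ₂, ?_⟩
  intro σ hσ hσlt Φ t₁ t₂ h₁ h₁₂ ε hε φ hφ
  obtain ⟨ℓ₁, hℓ₁, K1⟩ := H1 σ hσ (lt_of_lt_of_le hσlt (min_le_left σ₁ σ₂)) Φ t₁ t₂ h₁ h₁₂ (ε / 2)
    (half_pos hε) φ hφ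
  obtain ⟨ℓ₂, hℓ₂, K2⟩ := H2 σ hσ (lt_of_lt_of_le hσlt (min_le_right σ₁ σ₂)) Φ t₁ t₂ h₁ h₁₂ (ε / 2)
    (half_pos hε) φ hφ
  refine ⟨min ℓ₁ ℓ₂, lt_min hℓ₁ hℓ₂, fun k hk => ?_⟩
  filter_upwards [K1 k (kernel_mono (min_le_left ℓ₁ ℓ₂) hk),
    K2 k (kernel_mono (min_le_right ℓ₁ ℓ₂) hk)] with N hN1 hN2
  have hφ1 : Torus.IsContDiff 1 φ := hφ.isContDiff (by simp)
  refine integrable_and_abs_integral_le_of_ae_eq_add ?_ (hN1 _ rfl) (hN2 _ rfl)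
  filter_upwards [ae_mem_good_localGibbsLaw σ a₀ u₀ θ₀ N (Φ N)] with z hz
  have hbal := momentumObservable_flow_sub_flow (Φ N) hφ1 hz h₁₂
  simp only [sum_empiricalMomentumField_apply_eq]
  rw [← mul_sub, hbal]
  ring

/-- **GLUE E (sorry-free): kinetic energy-current closure + collisional energy-current closure ⇒ mean
energy-flux closure** (energy twin of `kinetic_collisional_imply_momentumFluxClosure`). -/
theorem kinetic_collisional_imply_energyFluxClosure :
    KineticEnergyCurrentClosure → CollisionalEnergyCurrentClosure → EnergyFluxClosure := by
  unfold KineticEnergyCurrentClosure CollisionalEnergyCurrentClosure EnergyFluxClosure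
  intro hKE hCE a₀ θ₀ u₀ ha hθ hu hap hθp
  obtain ⟨σ₁, hσ₁, H1⟩ := hKE a₀ θ₀ u₀ ha hθ hu hap hθp
  obtain ⟨σ₂, hσ₂, H2⟩ := hCE a₀ θ₀ u₀ ha hθ hu hap hθp
  refine ⟨min σ₁ σ₂, lt_min hσ₁ hσ₂, ?_⟩
  intro σ hσ hσlt Φ t₁ t₂ h₁ h₁₂ ε hε ψ hψ
  obtain ⟨ℓ₁, hℓ₁, K1⟩ := H1 σ hσ (lt_of_lt_of_le hσlt (min_le_left σ₁ σ₂)) Φ t₁ t₂ h₁ h₁₂ (ε / 2)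
    (half_pos hε) ψ hψ
  obtain ⟨ℓ₂, hℓ₂, K2⟩ := H2 σ hσ (lt_of_lt_of_le hσlt (min_le_right σ₁ σ₂)) Φ t₁ t₂ h₁ h₁₂ (ε / 2)
    (half_pos hε) ψ hψ
  refine ⟨min ℓ₁ ℓ₂, lt_min hℓ₁ hℓ₂, fun k hk => ?_⟩
  filter_upwards [K1 k (kernel_mono (min_le_left ℓ₁ ℓ₂) hk),
    K2 k (kernel_mono (min_le_right ℓ₁ ℓ₂) hk)] with N hN1 hN2
  have hψ1 : Torus.IsContDiff 1 ψ := hψ.isContDiff (by simp)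
  refine integrable_and_abs_integral_le_of_ae_eq_add ?_ (hN1 _ rfl) (hN2 _ rfl)
  filter_upwards [ae_mem_good_localGibbsLaw σ a₀ u₀ θ₀ N (Φ N)] with z hz
  have hbal := energyObservable_flow_sub_flow (Φ N) hψ1 hz h₁₂
  simp only [empiricalEnergyField_eq_energyObservable]
  rw [← mul_sub, hbal]
  ring

/-- The planner's stub M, now a THEOREM of the skeleton: mean momentum-flux (stress) closure from
KS (= stubs KS-a + KS-b) and stub CS. -/
theorem momentumFluxClosure : ∀ (a₀ θ₀ : Literature.MathematicalPhysics.KineticTheory.T3 → ℝ) (u₀ : Literature.MathematicalPhysics.KineticTheory.T3 → Literature.MathematicalPhysics.KineticTheory.V3), Continuous a₀ → Continuous θ₀ → Continuous u₀ → (∀ x, 0 < a₀ x) → (∀ x, 0 < θ₀ x) → ∃ σ₀ : ℝ, 0 < σ₀ ∧ ∀ σ : ℝ, 0 < σ → σ < σ₀ → ∀ Φ : (N : ℕ) → Literature.Analysis.FluidPDE.HardSphereFlow (Literature.Analysis.FluidPDE.Torus.geometry (Fin 3)) (Literature.MathematicalPhysics.KineticTheory.hsDiameter σ N) (N + 1),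 ∀ t₁ t₂ : ℝ, 0 ≤ t₁ → t₁ ≤ t₂ → ∀ ε : ℝ, 0 < ε → (∀ φ : Literature.MathematicalPhysics.KineticTheory.T3 → Literature.MathematicalPhysics.KineticTheory.V3, Literature.Analysis.FunctionSpaces.Torus.IsSmooth φ → ∃ ℓ : ℝ, 0 < ℓ ∧ ∀ k : Literature.MathematicalPhysics.KineticTheory.T3 → ℝ, (Continuous k ∧ (∀ y, 0 ≤ k y) ∧ (∫ y, k y = 1) ∧ (∀ y, k y ≠ 0 → Literature.Analysis.FluidPDE.Torus.euclidDist y 0 < ℓ)) → ∀ᶠ N in Filter.atTop, let D : Literature.Analysis.FluidPDE.Config (N + 1) (Fin 3) Literature.MathematicalPhysics.KineticTheory.T3 → ℝ := fun z => ((∑ i, (Literature.MathematicalPhysics.KineticTheory.empiricalMomentumField ((Φ N).flow t₂ z) (fun y => φ y i)) i) - (∑ i, (Literature.MathematicalPhysics.KineticTheory.empiricalMomentumField ((Φ N).flow t₁ z) (fun y => φ y i)) i)) - ∫ s in t₁..t₂, ∫ x, (let R : ℝ := Literature.MathematicalPhysics.KineticTheory.empiricalDensityField ((Φ N).flow s z)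 (fun y => k (x - y)); let Mv : Literature.MathematicalPhysics.KineticTheory.V3 := Literature.MathematicalPhysics.KineticTheory.empiricalMomentumField ((Φ N).flow s z) (fun y => k (x - y)); let En : ℝ := Literature.MathematicalPhysics.KineticTheory.empiricalEnergyField ((Φ N).flow s z) (fun y => k (x - y)); let Θ : ℝ := 2 / 3 * (En / R - ‖Mv‖ ^ 2 / (2 * R ^ 2)); let Pr : ℝ := Literature.MathematicalPhysics.KineticTheory.hsPressure σ R Θ; (∑ i, ∑ j, (Mv i * Mv j / R) * Literature.Analysis.FunctionSpaces.Torus.partialDeriv j (fun y => φ y i) x) + Pr * Literature.Analysis.FunctionSpaces.Torus.divergence φ x); MeasureTheory.Integrable D (Literature.MathematicalPhysics.KineticTheory.localGibbsLaw σ a₀ u₀ θ₀ N (Φ N)) ∧ |∫ z, D z ∂Literature.MathematicalPhysics.KineticTheory.localGibbsLaw σ a₀ u₀ θ₀ N (Φ N)| ≤ ε) := by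
  have h := kinetic_collisional_imply_momentumFluxClosure kineticStressClosure
  unfold CollisionalStressClosure MomentumFluxClosure at h
  exact h stub_collisionalStressClosure

/-- The planner's stub E, now a THEOREM of the skeleton: mean energy-flux (heat-current) closure from
KE (= stubs KE-a + KE-b) and stub CE. -/
theorem energyFluxClosure : ∀ (a₀ θ₀ : Literature.MathematicalPhysics.KineticTheory.T3 → ℝ) (u₀ : Literature.MathematicalPhysics.KineticTheory.T3 → Literature.MathematicalPhysics.KineticTheory.V3), Continuous a₀ → Continuous θ₀ → Continuous u₀ → (∀ x, 0 < a₀ x) → (∀ x, 0 < θ₀ x) → ∃ σ₀ : ℝ, 0 < σ₀ ∧ ∀ σ : ℝ, 0 < σ → σ < σ₀ → ∀ Φ : (N : ℕ) → Literature.Analysis.FluidPDE.HardSphereFlow (Literature.Analysis.FluidPDE.Torus.geometry (Fin 3)) (Literature.MathematicalPhysics.KineticTheory.hsDiameter σ N) (N + 1), ∀ t₁ t₂ : ℝ, 0 ≤ t₁ → t₁ ≤ t₂ → ∀ ε : ℝ, 0 < ε → (∀ ψ : Literature.MathematicalPhysics.KineticTheory.T3 → ℝ, Literature.Analysis.FunctionSpaces.Torus.IsSmooth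 ψ → ∃ ℓ : ℝ, 0 < ℓ ∧ ∀ k : Literature.MathematicalPhysics.KineticTheory.T3 → ℝ, (Continuous k ∧ (∀ y, 0 ≤ k y) ∧ (∫ y, k y = 1) ∧ (∀ y, k y ≠ 0 → Literature.Analysis.FluidPDE.Torus.euclidDist y 0 < ℓ)) → ∀ᶠ N in Filter.atTop, let D : Literature.Analysis.FluidPDE.Config (N + 1) (Fin 3) Literature.MathematicalPhysics.KineticTheory.T3 → ℝ := fun z => (Literature.MathematicalPhysics.KineticTheory.empiricalEnergyField ((Φ N).flow t₂ z) ψ - Literature.MathematicalPhysics.KineticTheory.empiricalEnergyField ((Φ N).flow t₁ z) ψ) - ∫ s in t₁..t₂, ∫ x, (let R : ℝ := Literature.MathematicalPhysics.KineticTheory.empiricalDensityField ((Φ N).flow s z) (fun y => k (x - y)); let Mv : Literature.MathematicalPhysics.KineticTheory.V3 := Literature.MathematicalPhysics.KineticTheory.empiricalMomentumField ((Φ N).flow s z) (fun y => k (x - y)); let En : ℝ := Literature.MathematicalPhysics.KineticTheory.empiricalEnergyField ((Φ N).flow s z) (fun y => k (x - y)); let Θ : ℝ := 2 / 3 * (En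 / R - ‖Mv‖ ^ 2 / (2 * R ^ 2)); let Pr : ℝ := Literature.MathematicalPhysics.KineticTheory.hsPressure σ R Θ; ((En + Pr) / R) * (∑ i, Mv i * Literature.Analysis.FunctionSpaces.Torus.partialDeriv i ψ x)); MeasureTheory.Integrable D (Literature.MathematicalPhysics.KineticTheory.localGibbsLaw σ a₀ u₀ θ₀ N (Φ N)) ∧ |∫ z, D z ∂Literature.MathematicalPhysics.KineticTheory.localGibbsLaw σ a₀ u₀ θ₀ N (Φ N)| ≤ ε) := by
  have h := kinetic_collisional_imply_energyFluxClosure kineticEnergyCurrentClosure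
  unfold CollisionalEnergyCurrentClosure EnergyFluxClosure at h
  exact h stub_collisionalEnergyCurrentClosure

/-! ## The planner's glue (verbatim) and the skeleton theorem -/

/-- THE FILED CRUX, VERBATIM (record). The decl `Summit.AtomisticToContinuum.HydrodynamicLimit.Theses.AnnealedZeroHorizon`’s `MeanFluxClosure`
(item stmt-AtomisticToContinuum-9256) as it stood in route AnnealedZeroHorizon rev ≤ 10; the decl was DROPPED from the route at rev 11
(2026-08-17T10:21Z, route-repair 2798150d: MeanSecondLaw refuted-misstated, load-bearing path re-typed as
`MeanMomentumClosureCut → MeanLocalSecondLaw → AnnealedWeakStrongR`, the momentum clause surviving as stmt-18014 with the CUT pressure).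
This local copy keeps the final skeleton r8 elaborating as a record; `MeanFluxClosure_of` below concludes it. -/
def MeanFluxClosureFiled : Prop := ∀ (a₀ θ₀ : Literature.MathematicalPhysics.KineticTheory.T3 → ℝ) (u₀ : Literature.MathematicalPhysics.KineticTheory.T3 → Literature.MathematicalPhysics.KineticTheory.V3), Continuous a₀ → Continuous θ₀ → Continuous u₀ → (∀ x, 0 < a₀ x) → (∀ x, 0 < θ₀ x) → ∃ σ₀ : ℝ, 0 < σ₀ ∧ ∀ σ : ℝ, 0 < σ → σ < σ₀ → ∀ Φ : (N : ℕ) → Literature.Analysis.FluidPDE.HardSphereFlow (Literature.Analysis.FluidPDE.Torus.geometry (Fin 3)) (Literature.MathematicalPhysics.KineticTheory.hsDiameter σ N) (N + 1), ∀ t₁ t₂ : ℝ, 0 ≤ t₁ → t₁ ≤ t₂ → ∀ ε : ℝ, 0 < ε → (∀ ψ : Literature.MathematicalPhysics.KineticTheory.T3 → ℝ, Literature.Analysis.FunctionSpaces.Torus.IsSmooth ψ → ∃ ℓ : ℝ, 0 < ℓ ∧ ∀ k : Literature.MathematicalPhysics.KineticTheory.T3 → ℝ, (Continuous k ∧ (∀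 y, 0 ≤ k y) ∧ (∫ y, k y = 1) ∧ (∀ y, k y ≠ 0 → Literature.Analysis.FluidPDE.Torus.euclidDist y 0 < ℓ)) → ∀ᶠ N in Filter.atTop, let D : Literature.Analysis.FluidPDE.Config (N + 1) (Fin 3) Literature.MathematicalPhysics.KineticTheory.T3 → ℝ := fun z => (Literature.MathematicalPhysics.KineticTheory.empiricalEnergyField ((Φ N).flow t₂ z) ψ - Literature.MathematicalPhysics.KineticTheory.empiricalEnergyField ((Φ N).flow t₁ z) ψ) - ∫ s in t₁..t₂, ∫ x, (let R : ℝ := Literature.MathematicalPhysics.KineticTheory.empiricalDensityField ((Φ N).flow s z) (fun y => k (x - y)); let Mv : Literature.MathematicalPhysics.KineticTheory.V3 := Literature.MathematicalPhysics.KineticTheory.empiricalMomentumField ((Φ N).flow s z) (fun y => k (x - y)); let En : ℝ := Literature.MathematicalPhysics.KineticTheory.empiricalEnergyField ((Φ N).flow s z) (fun y => k (x - y)); let Θ : ℝ := 2 / 3 * (En / R - ‖Mv‖ ^ 2 / (2 * R ^ 2)); let Pr : ℝ := Literature.MathematicalPhysics.KineticTheory.hsPressure σ R Θ; ((En + Pr)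 / R) * (∑ i, Mv i * Literature.Analysis.FunctionSpaces.Torus.partialDeriv i ψ x)); MeasureTheory.Integrable D (Literature.MathematicalPhysics.KineticTheory.localGibbsLaw σ a₀ u₀ θ₀ N (Φ N)) ∧ |∫ z, D z ∂Literature.MathematicalPhysics.KineticTheory.localGibbsLaw σ a₀ u₀ θ₀ N (Φ N)| ≤ ε) ∧ (∀ φ : Literature.MathematicalPhysics.KineticTheory.T3 → Literature.MathematicalPhysics.KineticTheory.V3, Literature.Analysis.FunctionSpaces.Torus.IsSmooth φ → ∃ ℓ : ℝ, 0 < ℓ ∧ ∀ k : Literature.MathematicalPhysics.KineticTheory.T3 → ℝ, (Continuous k ∧ (∀ y, 0 ≤ k y) ∧ (∫ y, k y = 1) ∧ (∀ y, k y ≠ 0 → Literature.Analysis.FluidPDE.Torus.euclidDist y 0 < ℓ)) → ∀ᶠ N in Filter.atTop, let D : Literature.Analysis.FluidPDE.Config (N + 1) (Fin 3) Literature.MathematicalPhysics.KineticTheory.T3 → ℝ := fun z => ((∑ i, (Literature.MathematicalPhysics.KineticTheory.empiricalMomentumField ((Φ N).flow t₂ z) (fun y => φ y i)) i) - (∑ i,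 (Literature.MathematicalPhysics.KineticTheory.empiricalMomentumField ((Φ N).flow t₁ z) (fun y => φ y i)) i)) - ∫ s in t₁..t₂, ∫ x, (let R : ℝ := Literature.MathematicalPhysics.KineticTheory.empiricalDensityField ((Φ N).flow s z) (fun y => k (x - y)); let Mv : Literature.MathematicalPhysics.KineticTheory.V3 := Literature.MathematicalPhysics.KineticTheory.empiricalMomentumField ((Φ N).flow s z) (fun y => k (x - y)); let En : ℝ := Literature.MathematicalPhysics.KineticTheory.empiricalEnergyField ((Φ N).flow s z) (fun y => k (x - y)); let Θ : ℝ := 2 / 3 * (En / R - ‖Mv‖ ^ 2 / (2 * R ^ 2)); let Pr : ℝ := Literature.MathematicalPhysics.KineticTheory.hsPressure σ R Θ; (∑ i, ∑ j, (Mv i * Mv j / R) * Literature.Analysis.FunctionSpaces.Torus.partialDeriv j (fun y => φ y i) x) + Pr * Literature.Analysis.FunctionSpaces.Torus.divergence φ x); MeasureTheory.Integrable D (Literature.MathematicalPhysics.KineticTheory.localGibbsLaw σ a₀ u₀ θ₀ N (Φ N)) ∧ |∫ z, D z ∂Literature.MathematicalPhysics.KineticTheory.localGibbsLaw σ a₀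 u₀ θ₀ N (Φ N)| ≤ ε)


/-- THE GLUE AS A PROPOSITION (planner, verbatim): the two constitutive closures (M-signature,
E-signature) imply the crux `MeanFluxClosure`. -/
def PartsImplyMeanFluxClosure : Prop :=
  (∀ (a₀ θ₀ : Literature.MathematicalPhysics.KineticTheory.T3 → ℝ) (u₀ : Literature.MathematicalPhysics.KineticTheory.T3 → Literature.MathematicalPhysics.KineticTheory.V3), Continuous a₀ → Continuous θ₀ → Continuous u₀ → (∀ x, 0 < a₀ x) → (∀ x, 0 < θ₀ x) → ∃ σ₀ : ℝ, 0 < σ₀ ∧ ∀ σ : ℝ, 0 < σ → σ < σ₀ → ∀ Φ : (N : ℕ) → Literature.Analysis.FluidPDE.HardSphereFlow (Literature.Analysis.FluidPDE.Torus.geometry (Fin 3)) (Literature.MathematicalPhysics.KineticTheory.hsDiameter σ N) (N + 1), ∀ t₁ t₂ : ℝ, 0 ≤ t₁ → t₁ ≤ t₂ → ∀ ε : ℝ, 0 < ε → (∀ φ : Literature.MathematicalPhysics.KineticTheory.T3 → Literature.MathematicalPhysics.KineticTheory.V3, Literature.Analysis.FunctionSpaces.Torus.IsSmooth φ → ∃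 ℓ : ℝ, 0 < ℓ ∧ ∀ k : Literature.MathematicalPhysics.KineticTheory.T3 → ℝ, (Continuous k ∧ (∀ y, 0 ≤ k y) ∧ (∫ y, k y = 1) ∧ (∀ y, k y ≠ 0 → Literature.Analysis.FluidPDE.Torus.euclidDist y 0 < ℓ)) → ∀ᶠ N in Filter.atTop, let D : Literature.Analysis.FluidPDE.Config (N + 1) (Fin 3) Literature.MathematicalPhysics.KineticTheory.T3 → ℝ := fun z => ((∑ i, (Literature.MathematicalPhysics.KineticTheory.empiricalMomentumField ((Φ N).flow t₂ z) (fun y => φ y i)) i) - (∑ i, (Literature.MathematicalPhysics.KineticTheory.empiricalMomentumField ((Φ N).flow t₁ z) (fun y => φ y i)) i)) - ∫ s in t₁..t₂, ∫ x, (let R : ℝ := Literature.MathematicalPhysics.KineticTheory.empiricalDensityField ((Φ N).flow s z) (fun y => k (x - y)); let Mv : Literature.MathematicalPhysics.KineticTheory.V3 := Literature.MathematicalPhysics.KineticTheory.empiricalMomentumField ((Φ N).flow s z) (fun y => k (x - y)); let En : ℝ := Literature.MathematicalPhysics.KineticTheory.empiricalEnergyField ((Φ N).flow s z) (fun y =>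 k (x - y)); let Θ : ℝ := 2 / 3 * (En / R - ‖Mv‖ ^ 2 / (2 * R ^ 2)); let Pr : ℝ := Literature.MathematicalPhysics.KineticTheory.hsPressure σ R Θ; (∑ i, ∑ j, (Mv i * Mv j / R) * Literature.Analysis.FunctionSpaces.Torus.partialDeriv j (fun y => φ y i) x) + Pr * Literature.Analysis.FunctionSpaces.Torus.divergence φ x); MeasureTheory.Integrable D (Literature.MathematicalPhysics.KineticTheory.localGibbsLaw σ a₀ u₀ θ₀ N (Φ N)) ∧ |∫ z, D z ∂Literature.MathematicalPhysics.KineticTheory.localGibbsLaw σ a₀ u₀ θ₀ N (Φ N)| ≤ ε)) → (∀ (a₀ θ₀ : Literature.MathematicalPhysics.KineticTheory.T3 → ℝ) (u₀ : Literature.MathematicalPhysics.KineticTheory.T3 → Literature.MathematicalPhysics.KineticTheory.V3), Continuous a₀ → Continuous θ₀ → Continuous u₀ → (∀ x, 0 < a₀ x) → (∀ x, 0 < θ₀ x) → ∃ σ₀ : ℝ, 0 < σ₀ ∧ ∀ σ : ℝ, 0 < σ → σ < σ₀ → ∀ Φ : (N : ℕ) → Literature.Analysis.FluidPDE.HardSphereFlow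 (Literature.Analysis.FluidPDE.Torus.geometry (Fin 3)) (Literature.MathematicalPhysics.KineticTheory.hsDiameter σ N) (N + 1), ∀ t₁ t₂ : ℝ, 0 ≤ t₁ → t₁ ≤ t₂ → ∀ ε : ℝ, 0 < ε → (∀ ψ : Literature.MathematicalPhysics.KineticTheory.T3 → ℝ, Literature.Analysis.FunctionSpaces.Torus.IsSmooth ψ → ∃ ℓ : ℝ, 0 < ℓ ∧ ∀ k : Literature.MathematicalPhysics.KineticTheory.T3 → ℝ, (Continuous k ∧ (∀ y, 0 ≤ k y) ∧ (∫ y, k y = 1) ∧ (∀ y, k y ≠ 0 → Literature.Analysis.FluidPDE.Torus.euclidDist y 0 < ℓ)) → ∀ᶠ N in Filter.atTop, let D : Literature.Analysis.FluidPDE.Config (N + 1) (Fin 3) Literature.MathematicalPhysics.KineticTheory.T3 → ℝ := fun z => (Literature.MathematicalPhysics.KineticTheory.empiricalEnergyField ((Φ N).flow t₂ z) ψ - Literature.MathematicalPhysics.KineticTheory.empiricalEnergyField ((Φ N).flow t₁ z) ψ) - ∫ s in t₁..t₂, ∫ x, (let R : ℝ := Literature.MathematicalPhysics.KineticTheory.empiricalDensityField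 ((Φ N).flow s z) (fun y => k (x - y)); let Mv : Literature.MathematicalPhysics.KineticTheory.V3 := Literature.MathematicalPhysics.KineticTheory.empiricalMomentumField ((Φ N).flow s z) (fun y => k (x - y)); let En : ℝ := Literature.MathematicalPhysics.KineticTheory.empiricalEnergyField ((Φ N).flow s z) (fun y => k (x - y)); let Θ : ℝ := 2 / 3 * (En / R - ‖Mv‖ ^ 2 / (2 * R ^ 2)); let Pr : ℝ := Literature.MathematicalPhysics.KineticTheory.hsPressure σ R Θ; ((En + Pr) / R) * (∑ i, Mv i * Literature.Analysis.FunctionSpaces.Torus.partialDeriv i ψ x)); MeasureTheory.Integrable D (Literature.MathematicalPhysics.KineticTheory.localGibbsLaw σ a₀ u₀ θ₀ N (Φ N)) ∧ |∫ z, D z ∂Literature.MathematicalPhysics.KineticTheory.localGibbsLaw σ a₀ u₀ θ₀ N (Φ N)| ≤ ε)) → MeanFluxClosureFiled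

/-- ASSEMBLY, hypotheses explicit (kernel-checked, NO sorry): merge the density thresholds
(σ₀ := min σ₀ᴹ σ₀ᴱ) and re-pair the energy and momentum conjuncts under the common prefix. -/
theorem parts_imply_meanFluxClosure : PartsImplyMeanFluxClosure := by
  unfold PartsImplyMeanFluxClosure
  intro hM hE
  unfold MeanFluxClosureFiled
  intro a₀ θ₀ u₀ ha hθ hu hap hθp
  obtain ⟨σM, hσM, HM⟩ := hM a₀ θ₀ u₀ ha hθ hu hap hθp
  obtain ⟨σE, hσE, HE⟩ := hE a₀ θ₀ u₀ ha hθ hu hap hθp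
  refine ⟨min σM σE, lt_min hσM hσE, ?_⟩
  intro σ hσ hσlt Φ t₁ t₂ h₁ h₁₂ ε hε
  exact ⟨HE σ hσ (lt_of_lt_of_le hσlt (min_le_right σM σE)) Φ t₁ t₂ h₁ h₁₂ ε hε,
    HM σ hσ (lt_of_lt_of_le hσlt (min_le_left σM σE)) Φ t₁ t₂ h₁ h₁₂ ε hε⟩

/-- THE SKELETON THEOREM (A12 layer invariant): concludes the (filed, now dropped) crux `MeanFluxClosureFiled` (verbatim local copy) with no
hypotheses; its only `sorryAx` dependence is through the six registered stubs `stub_deviatoricStressClosure`,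
`stub_relSpeedCollisionMeanBound`, `stub_collisionalVirialClosure`, `stub_collisionEnergyExchangeMeanBound`,
`stub_scaleHeatFluxClosure`, `stub_collisionalEnergyContactClosure` (KS-a and KE-a1 are landed theorems; CS, CE, KE-b are
theorems of the skeleton over landed support files). -/
theorem MeanFluxClosure_of : MeanFluxClosureFiled := by
  have h := parts_imply_meanFluxClosure
  unfold PartsImplyMeanFluxClosure at h
  exact h momentumFluxClosure energyFluxClosure

end

end Summit.AtomisticToContinuum.HydrodynamicLimit.Cruxes.MeanFluxClosure.Birth
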